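import Literature.NumberTheory.Sieve.DeshouillersIwaniecKuznetsovKernel
import Literature.NumberTheory.Sieve.KloostermanQuadraticFormsShort
import Literature.NumberTheory.Sieve.DeshouillersIwaniecLargeSieveHol
import HarnessLib

/-!
# The Kloosterman side of Kuznetsov's formula for the Gaussian test function (Deshouillers–Iwaniec §5.3)

Second step towards the large sieve inequalities [DeshouillersIwaniec1982, Theorem 2 (1.29)–(1.30)]
for the Maass and Eisenstein coefficients (the hypotheses `LSMaass*`, `LSEis*` of
`BFI.L1.BombieriFriedlanderIwaniecTheorem1_of_kuznetsov`).  In the spectral form of Kuznetsov's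
formula [Iwaniec2002, Theorem 9.3 (9.12)], divided by `4π` so that its spectral side is written with
the tree's arrays `P f n = √n ρ_f(n)` (`ν̄_{𝔞j}(m)ν_{𝔞j}(n) = (4π/ch πt_j) conj(P f m) P f n`,
[Iwaniec2002, (8.5)]), the Kloosterman side for the test function `h_K` of
`DeshouillersIwaniecKuznetsovKernel` at level `r` is `Σ_c kuzTerm r K m n c`,

  `kuzTerm r K m n c = [1 ≤ c, r ∣ c] (4πc)⁻¹ S(m,n;c) h_K⁺(4π√(mn)/c)`.

Pairing with `ā_m a_n` over the dyadic block `N < m, n ≤ 2N` gives `T_c` (`Tc`), and we prove, following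
[DeshouillersIwaniec1982, p. 261] range by range,

  `Σ_c ‖T_c‖ ≤ C K N^{1+6ε} r⁻¹ ‖a‖²`   (`kloostermanSide_le`; `K ≥ 1`, `r ≥ 1`, `N ≥ 1/2`),

the constant depending on `ε ∈ (0, 1/12]` and on the constant `A` of the short-range bound (1.27)
(`ShortRange ε A`, supplied by `norm_quadB_le_short`).  The two integral representations of `T_c` are
D–I's (5.7) (`Tc_eq_formA`: `T_c = (2π²c)⁻¹ ∫₀^∞ g_K(ξ)[B(ch ξ) + B(−ch ξ)] dξ` with `b = ā`) and (5.6)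
(`Tc_eq_formB`: `T_c = (2√πK³N/c²) i ∫₀^∞ γ_K sh ξ [B(−ch ξ) − B(ch ξ)] dξ` with `b‴_n = ā_n √(n/N)`),
where `B(θ) = B(θ; c, N, b)` is the quadratic form `quadB` of Proposition 3; the bounds (1.25), (1.26'),
(1.27) of `KloostermanQuadraticForms(Short)` are inserted on `ξ ≤ 1` / `ξ > 1` in the four ranges
`c > N²`, `N < c ≤ N²`, `N/K² < c ≤ N`, `c ≤ N/K²` exactly as in [DeshouillersIwaniec1982, p. 261]
(`norm_Tc_le_range1`–`4`), giving the uniform `‖T_c‖ ≤ C K N^{1+6ε} c^{−(1+ε)} ‖a‖²` (`norm_Tc_le`).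

## References
* [DeshouillersIwaniec1982] J.-M. Deshouillers, H. Iwaniec, *Kloosterman sums and Fourier coefficients
  of cusp forms*, Invent. Math. 70 (1982): §5.3 pp. 260–261, (5.6)–(5.7), Proposition 3.
* [Iwaniec2002] H. Iwaniec, *Spectral methods of automorphic forms*, 2nd ed., GSM 53: Theorem 9.3,
  (8.5)–(8.6), (9.9)–(9.12).
-/

noncomputable section

open Real MeasureTheory Set Filter
open scoped Topology

namespace Literature.NumberTheory.Sieve

namespace DeshouillersIwaniec


section Kloo

open Finset Complex BFI LargeSieve Literature.Analysis.FunctionSpaces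
open scoped ComplexConjugate

/-- The `c`-th term of the KLOOSTERMAN SIDE of Kuznetsov's formula [Iwaniec2002, (9.12)] for the test
function `h_K`, level `r`, `m, n ≥ 1`, after dividing (9.12) by `4π` (so that the spectral side is
`Σ_f h(t_f) conj(P f m) P f n / ch(πt_f) + …` for the tree's arrays `P f n = √n ρ_f(n)`, cf.
`ν̄_{𝔞j}(m)ν_{𝔞j}(n) = (4π/ch πt_j) conj(P m) P n` by [Iwaniec2002, (8.5)]):
`[1 ≤ c, r ∣ c] (4πc)⁻¹ S(m, n; c) h_K⁺(4π√(mn)/c)`. [cite: Iwaniec2002, Theorem 9.3 (9.12)] -/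
def kuzTerm (r : ℕ) (K : ℝ) (m n c : ℕ) : ℂ :=
  if 1 ≤ c ∧ r ∣ c then
    (((4 * π * c)⁻¹ * hPlus K (4 * π * Real.sqrt ((m : ℝ) * n) / c) : ℝ) : ℂ) * kloo m n c
  else 0

/-- A summable majorant of the Kloosterman side: `8e^{9/4}√π √(mn) √m τ(c) c^{−3/2}`
(`|h⁺(x)| ≤ 8e^{9/4}√π x` and Weil's bound). [folklore] -/
def kuzMaj (m n c : ℕ) : ℝ :=
  8 * Real.exp (9 / 4) * Real.sqrt π * Real.sqrt ((m : ℝ) * n) * Real.sqrt m * (c.divisors.card : ℝ) * (c : ℝ) ^ (-(3 / 2 : ℝ))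

/-- `0 ≤ kuzMaj`. [folklore] -/
theorem kuzMaj_nonneg (m n c : ℕ) : 0 ≤ kuzMaj m n c := by unfold kuzMaj; positivity

/-- `‖kuzTerm‖ ≤ kuzMaj` (`K ≥ 1`). [folklore] -/
theorem norm_kuzTerm_le (r : ℕ) {K : ℝ} (hK : 1 ≤ K) (m n c : ℕ) : ‖kuzTerm r K m n c‖ ≤ kuzMaj m n c := by
  unfold kuzTerm
  split_ifs with h
  · obtain ⟨hc, _⟩ := h
    have hc0 : (0 : ℝ) < c := by exact_mod_cast hc
    set x : ℝ := 4 * π * Real.sqrt ((m : ℝ) * n) / c with hx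
    have hx0 : 0 ≤ x := by positivity
    have hh := abs_hPlus_le_lin hK x
    rw [abs_of_nonneg hx0] at hh
    have hW := norm_kloo_le m n (c := c) hc
    have hkey : Real.sqrt ((m : ℝ) * n) * Real.sqrt (Int.gcd m c : ℝ) ≤ Real.sqrt ((m : ℝ) * n) * Real.sqrt m := by
      rcases Nat.eq_zero_or_pos m with hm | hm
      · subst hm; simp
      · refine mul_le_mul_of_nonneg_left (Real.sqrt_le_sqrt ?_) (Real.sqrt_nonneg _)
        have : Int.gcd (m : ℤ) (c : ℤ) ≤ m := by
          rw [Int.gcd_natCast_natCast]; exact Nat.le_of_dvd hm (Nat.gcd_dvd_left _ _)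
        exact_mod_cast this
    rw [norm_mul, Complex.norm_real, Real.norm_eq_abs, abs_mul, abs_inv,
      abs_of_pos (by positivity : (0 : ℝ) < 4 * π * c)]
    have hsc : 0 < Real.sqrt c := Real.sqrt_pos.2 hc0
    have hrpow : (c : ℝ) ^ (-(3 / 2 : ℝ)) = (c : ℝ)⁻¹ * (Real.sqrt c / c) := by
      have h32 : (c : ℝ) ^ ((3 : ℝ) / 2) = c * Real.sqrt c := by
        rw [show (3 : ℝ) / 2 = 1 + 1 / 2 by norm_num, Real.rpow_add hc0, Real.rpow_one, Real.sqrt_eq_rpow]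
      have hsq : Real.sqrt (c : ℝ) / c = (Real.sqrt c)⁻¹ := by
        rw [div_eq_iff hc0.ne', inv_mul_eq_div, eq_div_iff hsc.ne', Real.mul_self_sqrt hc0.le]
      rw [Real.rpow_neg hc0.le, h32, mul_inv, hsq]
    unfold kuzMaj
    rw [hrpow]
    calc (4 * π * c)⁻¹ * |hPlus K x| * ‖kloo m n c‖
        ≤ (4 * π * c)⁻¹ * (8 * Real.exp (9 / 4) * Real.sqrt π * x) *
            ((c.divisors.card : ℝ) * Real.sqrt c * Real.sqrt (Int.gcd m c : ℝ)) := by gcongr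
      _ = 8 * Real.exp (9 / 4) * Real.sqrt π * ((4 * π * c)⁻¹ * (4 * π / c)) * (c.divisors.card : ℝ) * Real.sqrt c *
            (Real.sqrt ((m : ℝ) * n) * Real.sqrt (Int.gcd m c : ℝ)) := by rw [hx]; ring
      _ ≤ 8 * Real.exp (9 / 4) * Real.sqrt π * ((4 * π * c)⁻¹ * (4 * π / c)) * (c.divisors.card : ℝ) * Real.sqrt c *
            (Real.sqrt ((m : ℝ) * n) * Real.sqrt m) := by gcongr
      _ = _ := by field_simp
  · rw [norm_zero]; exact kuzMaj_nonneg m n c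

/-- `kuzMaj m n` is summable in `c`. [folklore] -/
theorem summable_kuzMaj (m n : ℕ) : Summable (kuzMaj m n) := by
  obtain ⟨Cτ, hC1, hCτ⟩ := exists_card_divisors_le_mul_rpow' (ε := 1 / 4) (by norm_num)
  have hs : Summable fun c : ℕ => ((c : ℝ) ^ (5 / 4 : ℝ))⁻¹ := Real.summable_nat_rpow_inv.2 (by norm_num)
  refine Summable.of_nonneg_of_le (fun c => kuzMaj_nonneg m n c) (fun c => ?_)
    (hs.mul_left (8 * Real.exp (9 / 4) * Real.sqrt π * Real.sqrt ((m : ℝ) * n) * Real.sqrt m * Cτ))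
  unfold kuzMaj
  rcases Nat.eq_zero_or_pos c with hc | hc
  · subst hc
    simp [Real.zero_rpow (by norm_num : (-(3 / 2 : ℝ)) ≠ 0), Real.zero_rpow (by norm_num : (5 / 4 : ℝ) ≠ 0)]
  · have hc0 : (0 : ℝ) < c := by exact_mod_cast hc
    have h1 := hCτ c
    have h2 : (c : ℝ) ^ (1 / 4 : ℝ) * (c : ℝ) ^ (-(3 / 2 : ℝ)) = ((c : ℝ) ^ (5 / 4 : ℝ))⁻¹ := by
      rw [← Real.rpow_add hc0, ← Real.rpow_neg hc0.le]; norm_num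
    calc 8 * Real.exp (9 / 4) * Real.sqrt π * Real.sqrt ((m : ℝ) * n) * Real.sqrt m * (c.divisors.card : ℝ) * (c : ℝ) ^ (-(3 / 2 : ℝ))
        ≤ 8 * Real.exp (9 / 4) * Real.sqrt π * Real.sqrt ((m : ℝ) * n) * Real.sqrt m * (Cτ * (c : ℝ) ^ (1 / 4 : ℝ)) * (c : ℝ) ^ (-(3 / 2 : ℝ)) := by
          gcongr
      _ = _ := by rw [← h2]; ring

/-- The Kloosterman side converges absolutely (`K ≥ 1`). [folklore] -/
theorem summable_kuzTerm (r : ℕ) {K : ℝ} (hK : 1 ≤ K) (m n : ℕ) : Summable (kuzTerm r K m n) :=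
  Summable.of_norm_bounded (summable_kuzMaj m n) (norm_kuzTerm_le r hK m n)

end Kloo

section Forms

open Finset Complex BFI LargeSieve Literature.Analysis.FunctionSpaces
open scoped ComplexConjugate

/-- `T_c = ∑_{m,n ∼ N} ā_m a_n kuzTerm r K m n c`: the Kloosterman side paired with the sequence. [folklore] -/
def Tc (r : ℕ) (K N : ℝ) (a : ℕ → ℂ) (c : ℕ) : ℂ :=
  ∑ m ∈ dyadic N, ∑ n ∈ dyadic N, conj (a m) * a n * kuzTerm r K m n c

/-- The rescaled sequence `b‴_n = ā_n √(n/N)` of the partially integrated form (the factor `√(mn)`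
of `(4πc)⁻¹ x = 4π√(mn)/c²` absorbed). [folklore] -/
def bTh (N : ℝ) (a : ℕ → ℂ) (n : ℕ) : ℂ := conj (a n) * (Real.sqrt (n / N) : ℂ)

/-- `‖b‴‖² ≤ 2‖a‖²` (`n/N ≤ 2` on the dyadic range). [folklore] -/
theorem l2_bTh_le {N : ℝ} (hN : 0 ≤ N) (a : ℕ → ℂ) : l2 N (bTh N a) ≤ 2 * l2 N a := by
  rw [l2, l2, Finset.mul_sum]
  refine Finset.sum_le_sum fun n hn => ?_
  have h := ((mem_dyadic hN).1 hn)
  rcases eq_or_lt_of_le hN with h0 | hN0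
  · subst h0; simp [bTh]
  rw [bTh, norm_mul, Complex.norm_conj, mul_pow, Complex.norm_real, Real.norm_eq_abs, abs_of_nonneg (Real.sqrt_nonneg _),
    Real.sq_sqrt (by positivity)]
  have : (n : ℝ) / N ≤ 2 := by rw [div_le_iff₀ hN0]; linarith [h.2]
  calc ‖a n‖ ^ 2 * (n / N) ≤ ‖a n‖ ^ 2 * 2 := by gcongr
    _ = _ := by ring

/-- `e(2θ√(mn)/c) = exp(i x θ)` with `x = 4π√(mn)/c`. [folklore] -/
theorem e_phase_eq' (c m n : ℕ) (θ : ℝ) :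
    e (2 * θ * Real.sqrt ((m : ℝ) * n) / c) = Complex.exp (((4 * π * Real.sqrt ((m : ℝ) * n) / c * θ : ℝ) : ℂ) * I) := by
  rw [e_eq_exp]; congr 1; push_cast; ring

/-- `e(−2θ√(mn)/c) = exp(−i x θ)` with `x = 4π√(mn)/c`. [folklore] -/
theorem e_phase_neg (c m n : ℕ) (θ : ℝ) :
    e (2 * -θ * Real.sqrt ((m : ℝ) * n) / c) = Complex.exp (-(((4 * π * Real.sqrt ((m : ℝ) * n) / c * θ : ℝ)) : ℂ) * I) := by
  rw [e_eq_exp]; congr 1; push_cast; ring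

/-- `cos ξ · g` is integrable on `(0, ∞)`. [folklore] -/
theorem integrable_cos_mul_gGauss {K : ℝ} (hK : 1 ≤ K) (x : ℝ) :
    Integrable (fun ξ => Real.cos (x * Real.cosh ξ) * gGauss K ξ) (volume.restrict (Ioi 0)) := by
  obtain ⟨hgint, _⟩ := integral_abs_gGauss_le hK
  refine Integrable.mono' hgint.abs (by unfold gGauss; fun_prop) (Eventually.of_forall fun ξ => ?_)
  rw [Real.norm_eq_abs, abs_mul]
  exact mul_le_of_le_one_left (abs_nonneg _) (Real.abs_cos_le_one _)

/-- The complexified Bessel transform in exponential form: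
`h_K⁺(x) = (2/π) ∫₀^∞ g_K(ξ) (e^{ix ch ξ} + e^{−ix ch ξ}) dξ`. [cite: Iwaniec2002, (9.10)] -/
theorem ofReal_hPlus {K : ℝ} (hK : 1 ≤ K) (x : ℝ) :
    ((hPlus K x : ℝ) : ℂ) = 2 / π * ∫ ξ in Ioi (0 : ℝ), (gGauss K ξ : ℂ) *
      (Complex.exp (((x * Real.cosh ξ : ℝ) : ℂ) * I) + Complex.exp (-((x * Real.cosh ξ : ℝ) : ℂ) * I)) := by
  have hint := integrable_cos_mul_gGauss hK x
  have hcomm := (Complex.ofRealCLM.integral_comp_comm hint).symm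
  simp only [Complex.ofRealCLM_apply] at hcomm
  rw [hPlus, Complex.ofReal_mul, hcomm]
  have : ∀ ξ : ℝ, (((Real.cos (x * Real.cosh ξ) * gGauss K ξ : ℝ)) : ℂ) = (1 / 2 : ℂ) * ((gGauss K ξ : ℂ) *
      (Complex.exp (((x * Real.cosh ξ : ℝ) : ℂ) * I) + Complex.exp (-((x * Real.cosh ξ : ℝ) : ℂ) * I))) := by
    intro ξ
    push_cast
    rw [← Complex.two_cos]
    ring
  simp_rw [this]
  rw [integral_const_mul]
  push_cast
  ring

/-- **The direct form (5.7)** of the paired Kloosterman side: for `c ≥ 1`, `r ∣ c`,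
`T_c = (2π²c)⁻¹ ∫₀^∞ g_K(ξ) [B(ch ξ; c, N, ā) + B(−ch ξ; c, N, ā)] dξ`. [cite: DeshouillersIwaniec1982, (5.7)] -/
theorem Tc_eq_formA {r : ℕ} {K : ℝ} (hK : 1 ≤ K) (N : ℝ) (a : ℕ → ℂ) {c : ℕ} (hc : 1 ≤ c) (hrc : r ∣ c) :
    Tc r K N a c = (((2 * π ^ 2 * c)⁻¹ : ℝ) : ℂ) * ∫ ξ in Ioi (0 : ℝ), (gGauss K ξ : ℂ) *
      (quadB (Real.cosh ξ) c N (fun n => conj (a n)) + quadB (-Real.cosh ξ) c N (fun n => conj (a n))) := by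
  have hc0 : (0 : ℝ) < c := by exact_mod_cast hc
  have hπ := Real.pi_pos
  obtain ⟨hgint, _⟩ := integral_abs_gGauss_le hK
  -- the exponential kernel for the pair `(m, n)`
  set G : ℕ → ℕ → ℝ → ℂ := fun m n ξ => (gGauss K ξ : ℂ) *
    (Complex.exp (((4 * π * Real.sqrt ((m : ℝ) * n) / c * Real.cosh ξ : ℝ) : ℂ) * I) +
      Complex.exp (-((4 * π * Real.sqrt ((m : ℝ) * n) / c * Real.cosh ξ : ℝ) : ℂ) * I)) with hG
  have hGint : ∀ m n, Integrable (G m n) (volume.restrict (Ioi 0)) := by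
    intro m n
    have hcont : Continuous (G m n) := by
      simp only [hG]
      have : Continuous (gGauss K) := by unfold gGauss; fun_prop
      fun_prop
    refine Integrable.mono' (hgint.norm.const_mul 2) hcont.aestronglyMeasurable (Eventually.of_forall fun ξ => ?_)
    simp only [hG]
    rw [norm_mul, Complex.norm_real]
    calc ‖gGauss K ξ‖ * ‖_‖ ≤ ‖gGauss K ξ‖ * (1 + 1) := by
          gcongr
          refine (norm_add_le _ _).trans (add_le_add ?_ ?_) <;> rw [Complex.norm_exp] <;> simp
      _ = _ := by ring
  -- the summands of the right-hand side
  have hF : ∀ (m n : ℕ) (ξ : ℝ), (gGauss K ξ : ℂ) *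
      (conj (a m) * conj (conj (a n)) * kloo m n c * e (2 * Real.cosh ξ * Real.sqrt ((m : ℝ) * n) / c) +
        conj (a m) * conj (conj (a n)) * kloo m n c * e (2 * -Real.cosh ξ * Real.sqrt ((m : ℝ) * n) / c)) =
      (conj (a m) * a n * kloo m n c) * G m n ξ := by
    intro m n ξ
    simp only [hG, Complex.conj_conj]
    rw [e_phase_neg, e_phase_eq']
    ring
  -- expand the right-hand side
  have hexp : ∀ ξ : ℝ, (gGauss K ξ : ℂ) * (quadB (Real.cosh ξ) c N (fun n => conj (a n)) + quadB (-Real.cosh ξ) c N (fun n => conj (a n))) =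
      ∑ m ∈ dyadic N, ∑ n ∈ dyadic N, (conj (a m) * a n * kloo m n c) * G m n ξ := by
    intro ξ
    simp only [quadB, ← Finset.sum_add_distrib, Finset.mul_sum]
    refine Finset.sum_congr rfl fun m _ => Finset.sum_congr rfl fun n _ => ?_
    rw [← hF]
  simp_rw [hexp]
  rw [integral_finsetSum _ fun m _ => integrable_finsetSum _ fun n _ => (hGint m n).const_mul _]
  rw [Tc, Finset.mul_sum]
  refine Finset.sum_congr rfl fun m _ => ?_
  rw [integral_finsetSum _ fun n _ => (hGint m n).const_mul _, Finset.mul_sum]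
  refine Finset.sum_congr rfl fun n _ => ?_
  rw [integral_const_mul]
  rw [kuzTerm, if_pos ⟨hc, hrc⟩]
  push_cast
  rw [ofReal_hPlus hK]
  -- both sides are (constant) × the same integral
  have hZ : (∫ ξ in Ioi (0 : ℝ), (gGauss K ξ : ℂ) *
      (Complex.exp (((4 * π * Real.sqrt ((m : ℝ) * n) / c * Real.cosh ξ : ℝ) : ℂ) * I) +
        Complex.exp (-((4 * π * Real.sqrt ((m : ℝ) * n) / c * Real.cosh ξ : ℝ) : ℂ) * I))) = ∫ ξ in Ioi (0 : ℝ), G m n ξ := rfl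
  rw [hZ]
  have hπC : (π : ℂ) ≠ 0 := by exact_mod_cast Real.pi_ne_zero
  have hcC : (c : ℂ) ≠ 0 := by exact_mod_cast (show (c : ℕ) ≠ 0 by omega)
  field_simp
  ring

/-- `γ_K sh · sin` complexified: the partially integrated Bessel transform in exponential form. [folklore] -/
theorem ofReal_hPlus_formB {K : ℝ} (hK : 1 ≤ K) (x : ℝ) :
    ((hPlus K x : ℝ) : ℂ) = 4 * Real.sqrt π * K ^ 3 * x * ∫ ξ in Ioi (0 : ℝ), ((gamK K ξ * Real.sinh ξ : ℝ) : ℂ) *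
      ((Complex.exp (-((x * Real.cosh ξ : ℝ) : ℂ) * I) - Complex.exp (((x * Real.cosh ξ : ℝ) : ℂ) * I)) * I / 2) := by
  obtain ⟨hB, heq⟩ := hPlus_eq_formB hK x
  have hcomm := (Complex.ofRealCLM.integral_comp_comm hB).symm
  simp only [Complex.ofRealCLM_apply] at hcomm
  rw [heq]
  push_cast
  rw [hcomm]
  congr 1
  refine setIntegral_congr_fun measurableSet_Ioi fun ξ _ => ?_
  push_cast
  have hs := Complex.two_sin ((x : ℂ) * Complex.cosh (ξ : ℂ))
  linear_combination ((gamK K ξ : ℂ) * Complex.sinh (ξ : ℂ) / 2) * hs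

/-- **The partially integrated form (5.6)** of the paired Kloosterman side: for `c ≥ 1`, `r ∣ c`, `N > 0`,
`T_c = (2√πK³N/c²) i ∫₀^∞ γ_K(ξ) sh ξ [B(−ch ξ; c, N, b‴) − B(ch ξ; c, N, b‴)] dξ`
(`(4πc)⁻¹ x = 4π√(mn)/c²`, `√(mn) ā_m a_n = N b‴_m conj(b‴_n)`). [cite: DeshouillersIwaniec1982, (5.6)] -/
theorem Tc_eq_formB {r : ℕ} {K : ℝ} (hK : 1 ≤ K) {N : ℝ} (hN : 0 < N) (a : ℕ → ℂ) {c : ℕ} (hc : 1 ≤ c) (hrc : r ∣ c) :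
    Tc r K N a c = (((2 * Real.sqrt π * K ^ 3 * N / (c : ℝ) ^ 2 : ℝ)) : ℂ) * I *
      ∫ ξ in Ioi (0 : ℝ), ((gamK K ξ * Real.sinh ξ : ℝ) : ℂ) *
        (quadB (-Real.cosh ξ) c N (bTh N a) - quadB (Real.cosh ξ) c N (bTh N a)) := by
  have hc0 : (0 : ℝ) < c := by exact_mod_cast hc
  have hπ := Real.pi_pos
  obtain ⟨hγint, _⟩ := integral_gamK_sinh_le hK
  set G : ℕ → ℕ → ℝ → ℂ := fun m n ξ => ((gamK K ξ * Real.sinh ξ : ℝ) : ℂ) *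
    ((Complex.exp (-((4 * π * Real.sqrt ((m : ℝ) * n) / c * Real.cosh ξ : ℝ) : ℂ) * I) -
      Complex.exp (((4 * π * Real.sqrt ((m : ℝ) * n) / c * Real.cosh ξ : ℝ) : ℂ) * I)) * I / 2) with hG
  have hGint : ∀ m n, Integrable (G m n) (volume.restrict (Ioi 0)) := by
    intro m n
    have hcont : Continuous (G m n) := by
      simp only [hG]
      have : Continuous (gamK K) := by unfold gamK; fun_prop
      fun_prop
    refine Integrable.mono' hγint hcont.aestronglyMeasurable ((ae_restrict_iff' measurableSet_Ioi).2
      (Eventually.of_forall fun ξ hξ => ?_))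
    simp only [hG]
    have h0 : 0 ≤ gamK K ξ * Real.sinh ξ := mul_nonneg (gamK_nonneg K (le_of_lt hξ)) (Real.sinh_nonneg_iff.2 (le_of_lt hξ))
    rw [norm_mul, Complex.norm_real, Real.norm_of_nonneg h0]
    calc gamK K ξ * Real.sinh ξ * ‖_‖ ≤ gamK K ξ * Real.sinh ξ * ((1 + 1) * 1 / 2) := by
          gcongr
          rw [norm_div, norm_mul, Complex.norm_I, Complex.norm_two]
          gcongr
          refine (norm_sub_le _ _).trans (add_le_add ?_ ?_) <;> rw [Complex.norm_exp] <;> simp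
      _ ≤ gamK K ξ * Real.sinh ξ * (1 + Real.cosh ξ) := by
          gcongr; linarith [Real.cosh_pos ξ]
  have hF : ∀ (m n : ℕ) (ξ : ℝ), ((gamK K ξ * Real.sinh ξ : ℝ) : ℂ) *
      (bTh N a m * conj (bTh N a n) * kloo m n c * e (2 * -Real.cosh ξ * Real.sqrt ((m : ℝ) * n) / c) -
        bTh N a m * conj (bTh N a n) * kloo m n c * e (2 * Real.cosh ξ * Real.sqrt ((m : ℝ) * n) / c)) =
      (2 * (bTh N a m * conj (bTh N a n)) * kloo m n c * (-I)) * G m n ξ := by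
    intro m n ξ
    simp only [hG]
    rw [e_phase_neg, e_phase_eq']
    have hI : (I : ℂ) * I = -1 := Complex.I_mul_I
    linear_combination (bTh N a m * conj (bTh N a n) * kloo m n c * ((gamK K ξ * Real.sinh ξ : ℝ) : ℂ) *
      (Complex.exp (-((4 * π * Real.sqrt ((m : ℝ) * n) / c * Real.cosh ξ : ℝ) : ℂ) * I) -
        Complex.exp (((4 * π * Real.sqrt ((m : ℝ) * n) / c * Real.cosh ξ : ℝ) : ℂ) * I))) * hI
  have hexp : ∀ ξ : ℝ, ((gamK K ξ * Real.sinh ξ : ℝ) : ℂ) *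
      (quadB (-Real.cosh ξ) c N (bTh N a) - quadB (Real.cosh ξ) c N (bTh N a)) =
      ∑ m ∈ dyadic N, ∑ n ∈ dyadic N, (2 * (bTh N a m * conj (bTh N a n)) * kloo m n c * (-I)) * G m n ξ := by
    intro ξ
    simp only [quadB, ← Finset.sum_sub_distrib, Finset.mul_sum]
    refine Finset.sum_congr rfl fun m _ => Finset.sum_congr rfl fun n _ => ?_
    rw [← hF]
  simp_rw [hexp]
  rw [integral_finsetSum _ fun m _ => integrable_finsetSum _ fun n _ => (hGint m n).const_mul _]
  rw [Tc, Finset.mul_sum]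
  refine Finset.sum_congr rfl fun m hm => ?_
  rw [integral_finsetSum _ fun n _ => (hGint m n).const_mul _, Finset.mul_sum]
  refine Finset.sum_congr rfl fun n hn => ?_
  rw [integral_const_mul]
  have hm0 : (0 : ℝ) < m := by exact_mod_cast pos_of_mem_dyadic hN.le hm
  have hn0 : (0 : ℝ) < n := by exact_mod_cast pos_of_mem_dyadic hN.le hn
  have hmn : 0 < Real.sqrt ((m : ℝ) * n) := Real.sqrt_pos.2 (by positivity)
  -- `b‴_m conj(b‴_n) = ā_m a_n √(mn)/N`
  have hbb : bTh N a m * conj (bTh N a n) = conj (a m) * a n * (((Real.sqrt ((m : ℝ) * n) / N : ℝ)) : ℂ) := by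
    simp only [bTh, map_mul, Complex.conj_conj, Complex.conj_ofReal]
    have : Real.sqrt (m / N) * Real.sqrt (n / N) = Real.sqrt ((m : ℝ) * n) / N := by
      rw [← Real.sqrt_mul (by positivity), show (m : ℝ) / N * (n / N) = ((m : ℝ) * n) / N ^ 2 by field_simp,
        Real.sqrt_div (by positivity), Real.sqrt_sq hN.le]
    rw [show conj (a m) * (Real.sqrt (m / N) : ℂ) * (a n * (Real.sqrt (n / N) : ℂ)) =
      conj (a m) * a n * ((Real.sqrt (m / N) * Real.sqrt (n / N) : ℝ) : ℂ) by push_cast; ring, this]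
  rw [kuzTerm, if_pos ⟨hc, hrc⟩]
  push_cast
  rw [ofReal_hPlus_formB hK, hbb]
  have hZ : (∫ ξ in Ioi (0 : ℝ), ((gamK K ξ * Real.sinh ξ : ℝ) : ℂ) *
      ((Complex.exp (-((4 * π * Real.sqrt ((m : ℝ) * n) / c * Real.cosh ξ : ℝ) : ℂ) * I) -
        Complex.exp (((4 * π * Real.sqrt ((m : ℝ) * n) / c * Real.cosh ξ : ℝ) : ℂ) * I)) * I / 2)) = ∫ ξ in Ioi (0 : ℝ), G m n ξ := rfl
  rw [hZ]
  have hπC : (π : ℂ) ≠ 0 := by exact_mod_cast Real.pi_ne_zero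
  have hNC : (N : ℂ) ≠ 0 := by exact_mod_cast hN.ne'
  have hcC' : (c : ℂ) ≠ 0 := by exact_mod_cast (show (c : ℕ) ≠ 0 by omega)
  have key : (I : ℂ) * -I = 1 := by rw [mul_neg, Complex.I_mul_I, neg_neg]
  set Z := ∫ ξ in Ioi (0 : ℝ), G m n ξ with hZdef
  refine Eq.symm ?_
  calc (2 * (Real.sqrt π : ℂ) * (K : ℂ) ^ 3 * (N : ℂ) / (c : ℂ) ^ 2) * I *
        (2 * (conj (a m) * a n * (((Real.sqrt ((m : ℝ) * n) / N : ℝ)) : ℂ)) * kloo m n c * -I * Z)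
      = (2 * (Real.sqrt π : ℂ) * (K : ℂ) ^ 3 * (N : ℂ) / (c : ℂ) ^ 2) * (I * -I) *
          (2 * (conj (a m) * a n * (((Real.sqrt ((m : ℝ) * n) / N : ℝ)) : ℂ)) * kloo m n c * Z) := by ring
    _ = (2 * (Real.sqrt π : ℂ) * (K : ℂ) ^ 3 * (N : ℂ) / (c : ℂ) ^ 2) *
          (2 * (conj (a m) * a n * (((Real.sqrt ((m : ℝ) * n) / N : ℝ)) : ℂ)) * kloo m n c * Z) := by rw [key, mul_one]
    _ = _ := by
        push_cast
        field_simp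
        ring

/-! ### From the two forms to bounds: splitting the `ξ`-integral at `ξ = 1` -/

/-- Generic weighted bound: if `‖f‖ ≤ M₁` on `(0,1]` and `‖f‖ ≤ M_∞ (1 + ch ξ)` on `(1,∞)` then
`‖∫₀^∞ w f‖ ≤ M₁ ∫₀^∞ |w| + M_∞ ∫₁^∞ |w| (1 + ch)`. [folklore] -/
theorem norm_integral_weight_le {w : ℝ → ℝ} {f : ℝ → ℂ} {M₁ M₂ : ℝ} (hM₁ : 0 ≤ M₁)
    (hwi : IntegrableOn w (Ioi 0)) (hwt : IntegrableOn (fun ξ => |w ξ| * (1 + Real.cosh ξ)) (Ioi 1))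
    (h1 : ∀ ξ, 0 < ξ → ξ ≤ 1 → ‖f ξ‖ ≤ M₁) (h2 : ∀ ξ, 1 < ξ → ‖f ξ‖ ≤ M₂ * (1 + Real.cosh ξ)) :
    ‖∫ ξ in Ioi (0 : ℝ), (w ξ : ℂ) * f ξ‖ ≤ M₁ * (∫ ξ in Ioi (0 : ℝ), |w ξ|) + M₂ * ∫ ξ in Ioi (1 : ℝ), |w ξ| * (1 + Real.cosh ξ) := by
  set g : ℝ → ℝ := fun ξ => M₁ * |w ξ| + M₂ * (Ioi (1 : ℝ)).indicator (fun ξ => |w ξ| * (1 + Real.cosh ξ)) ξ with hg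
  have hind : IntegrableOn ((Ioi (1 : ℝ)).indicator fun ξ => |w ξ| * (1 + Real.cosh ξ)) (Ioi 0) :=
    (hwt.integrable_indicator measurableSet_Ioi).integrableOn
  have hgi : Integrable g (volume.restrict (Ioi 0)) := (hwi.abs.const_mul M₁).add (hind.const_mul M₂)
  have hle : ∀ᵐ ξ ∂(volume.restrict (Ioi (0 : ℝ))), ‖(w ξ : ℂ) * f ξ‖ ≤ g ξ := by
    refine (ae_restrict_iff' measurableSet_Ioi).2 (Eventually.of_forall fun ξ hξ => ?_)
    rw [norm_mul, Complex.norm_real, Real.norm_eq_abs]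
    simp only [hg]
    rcases le_or_gt ξ 1 with h | h
    · rw [Set.indicator_of_notMem (by simpa using h), mul_zero, add_zero, mul_comm]
      exact mul_le_mul_of_nonneg_right (h1 ξ hξ h) (abs_nonneg _)
    · rw [Set.indicator_of_mem (by simpa using h)]
      calc |w ξ| * ‖f ξ‖ ≤ |w ξ| * (M₂ * (1 + Real.cosh ξ)) := mul_le_mul_of_nonneg_left (h2 ξ h) (abs_nonneg _)
        _ = 0 + M₂ * (|w ξ| * (1 + Real.cosh ξ)) := by ring
        _ ≤ M₁ * |w ξ| + M₂ * (|w ξ| * (1 + Real.cosh ξ)) := by gcongr; positivity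
  refine (norm_integral_le_of_norm_le hgi hle).trans (le_of_eq ?_)
  simp only [hg]
  rw [integral_add (hwi.abs.const_mul M₁) (hind.const_mul M₂), integral_const_mul, integral_const_mul,
    setIntegral_indicator measurableSet_Ioi, Set.Ioi_inter_Ioi, show max (0 : ℝ) 1 = 1 by norm_num]

/-- `|g_K| (1 + ch)` is integrable on `(1, ∞)` and `γ_K sh (1 + ch)` on `(1, ∞)`. [folklore] -/
theorem integrableOn_tails {K : ℝ} (hK : 1 ≤ K) :
    IntegrableOn (fun ξ => |gGauss K ξ| * (1 + Real.cosh ξ)) (Ioi 1) ∧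
      IntegrableOn (fun ξ => |gamK K ξ * Real.sinh ξ| * (1 + Real.cosh ξ)) (Ioi 1) := by
  refine ⟨(integral_tail_le hK).1, ?_⟩
  have h := ((integral_gamK_sinh_le hK).1).mono_set (Ioi_subset_Ioi (by norm_num : (0 : ℝ) ≤ 1))
  refine h.congr_fun (fun ξ hξ => ?_) measurableSet_Ioi
  have hξ0 : 0 ≤ ξ := by have := le_of_lt (show (1 : ℝ) < ξ from hξ); linarith
  rw [abs_of_nonneg (mul_nonneg (gamK_nonneg K hξ0) (Real.sinh_nonneg_iff.2 hξ0))]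

/-- **Bound from the direct form**: `‖T_c‖ ≤ (2π²Nc)⁻¹ (3e^{9/4}π√π K² M₁ + 40e²π√π K⁵ e^{−K²/2} M_∞)`.
[cite: DeshouillersIwaniec1982, §5.3 p. 261] -/
theorem norm_Tc_le_formA {r : ℕ} {K : ℝ} (hK : 1 ≤ K) (N : ℝ) (a : ℕ → ℂ) {c : ℕ} (hc : 1 ≤ c)
    (hrc : r ∣ c) {M₁ M₂ : ℝ} (hM₁ : 0 ≤ M₁) (hM₂ : 0 ≤ M₂)
    (h1 : ∀ ξ, 0 < ξ → ξ ≤ 1 → ‖quadB (Real.cosh ξ) c N (fun n => conj (a n))‖ + ‖quadB (-Real.cosh ξ) c N (fun n => conj (a n))‖ ≤ M₁)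
    (h2 : ∀ ξ, 1 < ξ → ‖quadB (Real.cosh ξ) c N (fun n => conj (a n))‖ + ‖quadB (-Real.cosh ξ) c N (fun n => conj (a n))‖ ≤ M₂ * (1 + Real.cosh ξ)) :
    ‖Tc r K N a c‖ ≤ (2 * π ^ 2 * c)⁻¹ * (3 * Real.exp (9 / 4) * (π * Real.sqrt π) * K ^ 2 * M₁ +
      40 * Real.exp 2 * (π * Real.sqrt π) * K ^ 5 * Real.exp (-(K ^ 2 / 2)) * M₂) := by
  have hc0 : (0 : ℝ) < c := by exact_mod_cast hc
  obtain ⟨hgint, hgle⟩ := integral_abs_gGauss_le hK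
  obtain ⟨_, htail⟩ := integral_tail_le hK
  rw [Tc_eq_formA hK N a hc hrc, norm_mul, Complex.norm_real, Real.norm_of_nonneg (by positivity)]
  refine mul_le_mul_of_nonneg_left ?_ (by positivity)
  have hw := norm_integral_weight_le hM₁ hgint (integrableOn_tails hK).1
    (f := fun ξ => quadB (Real.cosh ξ) c N (fun n => conj (a n)) + quadB (-Real.cosh ξ) c N (fun n => conj (a n)))
    (fun ξ hξ hξ1 => (norm_add_le _ _).trans (h1 ξ hξ hξ1)) (fun ξ hξ => (norm_add_le _ _).trans (h2 ξ hξ))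
  refine hw.trans ?_
  calc M₁ * (∫ ξ in Ioi (0 : ℝ), |gGauss K ξ|) + M₂ * ∫ ξ in Ioi (1 : ℝ), |gGauss K ξ| * (1 + Real.cosh ξ)
      ≤ M₁ * (3 * Real.exp (9 / 4) * (π * Real.sqrt π) * K ^ 2) + M₂ * (40 * Real.exp 2 * (π * Real.sqrt π) * K ^ 5 * Real.exp (-(K ^ 2 / 2))) := by
        gcongr
    _ = _ := by ring

/-- **Bound from the partially integrated form**: `‖T_c‖ ≤ (2√πK³/c²) (2e^{9/4}K⁻³ M₁ + 4e^{9/2}e^{−K²/2} M_∞)`.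
[cite: DeshouillersIwaniec1982, §5.3 p. 261] -/
theorem norm_Tc_le_formB {r : ℕ} {K : ℝ} (hK : 1 ≤ K) {N : ℝ} (hN : 0 < N) (a : ℕ → ℂ) {c : ℕ} (hc : 1 ≤ c)
    (hrc : r ∣ c) {M₁ M₂ : ℝ} (hM₁ : 0 ≤ M₁) (hM₂ : 0 ≤ M₂)
    (h1 : ∀ ξ, 0 < ξ → ξ ≤ 1 → ‖quadB (Real.cosh ξ) c N (bTh N a)‖ + ‖quadB (-Real.cosh ξ) c N (bTh N a)‖ ≤ M₁)
    (h2 : ∀ ξ, 1 < ξ → ‖quadB (Real.cosh ξ) c N (bTh N a)‖ + ‖quadB (-Real.cosh ξ) c N (bTh N a)‖ ≤ M₂ * (1 + Real.cosh ξ)) :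
    ‖Tc r K N a c‖ ≤ 2 * Real.sqrt π * K ^ 3 * N / (c : ℝ) ^ 2 * (2 * Real.exp (9 / 4) / K ^ 3 * M₁ + 4 * Real.exp (9 / 2) * Real.exp (-(K ^ 2 / 2)) * M₂) := by
  have hc0 : (0 : ℝ) < c := by exact_mod_cast hc
  have hK0 : 0 < K := by linarith
  obtain ⟨hγint, hγle⟩ := integral_gamK_sinh_le hK
  have hγtail := integral_gamK_tail_le hK
  rw [Tc_eq_formB hK hN a hc hrc, norm_mul, norm_mul, Complex.norm_I, mul_one, Complex.norm_real,
    Real.norm_of_nonneg (by positivity)]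
  refine mul_le_mul_of_nonneg_left ?_ (by positivity)
  -- the weight `γ sh` is integrable on `(0, ∞)` (dominated by `γ sh (1 + ch)`)
  have hwi : IntegrableOn (fun ξ => gamK K ξ * Real.sinh ξ) (Ioi 0) := by
    refine Integrable.mono' hγint (by unfold gamK; fun_prop) ((ae_restrict_iff' measurableSet_Ioi).2
      (Eventually.of_forall fun ξ hξ => ?_))
    have h0 : 0 ≤ gamK K ξ * Real.sinh ξ := mul_nonneg (gamK_nonneg K (le_of_lt hξ)) (Real.sinh_nonneg_iff.2 (le_of_lt hξ))
    rw [Real.norm_of_nonneg h0]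
    calc gamK K ξ * Real.sinh ξ = gamK K ξ * Real.sinh ξ * 1 := (mul_one _).symm
      _ ≤ _ := by gcongr; linarith [Real.cosh_pos ξ]
  have hw := norm_integral_weight_le hM₁ hwi (integrableOn_tails hK).2
    (f := fun ξ => quadB (-Real.cosh ξ) c N (bTh N a) - quadB (Real.cosh ξ) c N (bTh N a))
    (fun ξ hξ hξ1 => (norm_sub_le _ _).trans (by rw [add_comm]; exact h1 ξ hξ hξ1))
    (fun ξ hξ => (norm_sub_le _ _).trans (by rw [add_comm]; exact h2 ξ hξ))
  have hw' : ‖∫ ξ in Ioi (0 : ℝ), ((gamK K ξ * Real.sinh ξ : ℝ) : ℂ) *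
      (quadB (-Real.cosh ξ) c N (bTh N a) - quadB (Real.cosh ξ) c N (bTh N a))‖ ≤
      M₁ * (∫ ξ in Ioi (0 : ℝ), |gamK K ξ * Real.sinh ξ|) + M₂ * ∫ ξ in Ioi (1 : ℝ), |gamK K ξ * Real.sinh ξ| * (1 + Real.cosh ξ) := hw
  refine hw'.trans ?_
  -- `∫₀^∞ |γ sh| ≤ ∫₀^∞ γ sh (1 + ch) ≤ 2e^{9/4}/K³`, `∫₁^∞ |γ sh| (1 + ch) ≤ 4e^{9/2} e^{−K²/2}`
  have hI1 : ∫ ξ in Ioi (0 : ℝ), |gamK K ξ * Real.sinh ξ| ≤ 2 * Real.exp (9 / 4) / K ^ 3 := by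
    refine le_trans (setIntegral_mono_on hwi.abs hγint measurableSet_Ioi fun ξ hξ => ?_) hγle
    have h0 : 0 ≤ gamK K ξ * Real.sinh ξ := mul_nonneg (gamK_nonneg K (le_of_lt hξ)) (Real.sinh_nonneg_iff.2 (le_of_lt hξ))
    rw [abs_of_nonneg h0]
    calc gamK K ξ * Real.sinh ξ = gamK K ξ * Real.sinh ξ * 1 := (mul_one _).symm
      _ ≤ _ := by gcongr; linarith [Real.cosh_pos ξ]
  have hI2 : ∫ ξ in Ioi (1 : ℝ), |gamK K ξ * Real.sinh ξ| * (1 + Real.cosh ξ) ≤ 4 * Real.exp (9 / 2) * Real.exp (-(K ^ 2 / 2)) := by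
    refine le_trans (le_of_eq (setIntegral_congr_fun measurableSet_Ioi fun ξ hξ => ?_)) hγtail
    have hξ0 : 0 ≤ ξ := by have := le_of_lt (show (1 : ℝ) < ξ from hξ); linarith
    rw [abs_of_nonneg (mul_nonneg (gamK_nonneg K hξ0) (Real.sinh_nonneg_iff.2 hξ0))]
  calc M₁ * (∫ ξ in Ioi (0 : ℝ), |gamK K ξ * Real.sinh ξ|) + M₂ * ∫ ξ in Ioi (1 : ℝ), |gamK K ξ * Real.sinh ξ| * (1 + Real.cosh ξ)
      ≤ M₁ * (2 * Real.exp (9 / 4) / K ^ 3) + M₂ * (4 * Real.exp (9 / 2) * Real.exp (-(K ^ 2 / 2))) := by gcongr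
    _ = _ := by ring

/-! ### Elementary inequalities for the range analysis -/

/-- `K^j e^{−K²/2} ≤ 48` for `j ≤ 6`, `K ≥ 1` (from `x³/3! ≤ eˣ`). [folklore] -/
theorem pow_mul_exp_neg_le {K : ℝ} (hK : 1 ≤ K) {j : ℕ} (hj : j ≤ 6) : K ^ j * Real.exp (-(K ^ 2 / 2)) ≤ 48 := by
  have h := Real.pow_div_factorial_le_exp (x := K ^ 2 / 2) (by positivity) 3
  have h6 : K ^ 6 ≤ 48 * Real.exp (K ^ 2 / 2) := by
    have : (K ^ 2 / 2) ^ 3 / (Nat.factorial 3 : ℝ) = K ^ 6 / 48 := by norm_num [Nat.factorial]; ring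
    rw [this] at h; linarith
  have hj' : K ^ j ≤ K ^ 6 := pow_le_pow_right₀ hK hj
  rw [Real.exp_neg, ← div_eq_mul_inv, div_le_iff₀ (Real.exp_pos _)]
  linarith

/-- `ch 1 < 2`. [folklore] -/
theorem cosh_one_lt_two : Real.cosh 1 < 2 := by
  rw [Real.cosh_eq]
  have h1 := Real.exp_one_lt_d9
  have h2 : Real.exp (-1) < 1 := Real.exp_lt_one_iff.2 (by norm_num)
  linarith

/-- For `0 < ξ ≤ 1`: `1 ≤ ch ξ ≤ ch 1 < 2`. [folklore] -/
theorem cosh_le_two_of_le_one {ξ : ℝ} (hξ0 : 0 ≤ ξ) (hξ : ξ ≤ 1) : Real.cosh ξ ≤ 2 := by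
  have : Real.cosh ξ ≤ Real.cosh 1 := Real.cosh_le_cosh.2 (by rw [abs_of_nonneg hξ0, abs_one]; exact hξ)
  linarith [cosh_one_lt_two]

/-- `N^{e₁} ≤ 2 N^{e₂}` for `N ≥ 1/2`, `0 ≤ e₁ ≤ e₂ ≤ 1`. [folklore] -/
theorem rpow_le_two_mul_rpow {N e₁ e₂ : ℝ} (hN : 1 / 2 ≤ N) (he₁ : 0 ≤ e₁) (he : e₁ ≤ e₂) (he₂ : e₂ ≤ 1) :
    N ^ e₁ ≤ 2 * N ^ e₂ := by
  have hN0 : 0 < N := by linarith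
  rcases le_or_gt 1 N with h | h
  · calc N ^ e₁ ≤ N ^ e₂ := Real.rpow_le_rpow_of_exponent_le h he
      _ ≤ 2 * N ^ e₂ := by linarith [Real.rpow_nonneg hN0.le e₂]
  · have h1 : N ^ e₁ ≤ 1 := Real.rpow_le_one hN0.le h.le he₁
    have h2 : (1 / 2 : ℝ) ≤ N ^ e₂ := by
      calc (1 / 2 : ℝ) = (1 / 2 : ℝ) ^ (1 : ℝ) := by simp
        _ ≤ (1 / 2 : ℝ) ^ e₂ := Real.rpow_le_rpow_of_exponent_ge (by norm_num) (by norm_num) he₂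
        _ ≤ N ^ e₂ := Real.rpow_le_rpow (by norm_num) hN (by linarith)
    linarith

/-- `(K²)^w ≤ K` for `K ≥ 1`, `w ≤ 1/2`. [folklore] -/
theorem sq_rpow_le {K w : ℝ} (hK : 1 ≤ K) (hw : w ≤ 1 / 2) : (K ^ 2) ^ w ≤ K := by
  have hK0 : 0 < K := by linarith
  rw [← Real.rpow_natCast K 2, ← Real.rpow_mul hK0.le]
  calc K ^ ((2 : ℕ) * w) ≤ K ^ (1 : ℝ) := Real.rpow_le_rpow_of_exponent_le hK (by push_cast; linarith)
    _ = K := Real.rpow_one K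

/-- Splitting off `c^{−(1+ε)}`: `c^u = c^{−(1+ε)} c^{u+1+ε}` (`c > 0`). [folklore] -/
theorem rpow_split {c : ℝ} (hc : 0 < c) (u ε : ℝ) : c ^ u = c ^ (-(1 + ε)) * c ^ (u + 1 + ε) := by
  rw [← Real.rpow_add hc]; ring_nf

/-! ### The inputs from Proposition 3 at `θ = ±ch ξ` -/

/-- (1.25) at `±ch ξ`. [cite: DeshouillersIwaniec1982, Proposition 3 (1.25)] -/
theorem pair_le_weil {c : ℕ} (hc : 1 ≤ c) {N : ℝ} (hN : 1 / 2 ≤ N) (b : ℕ → ℂ) (ξ : ℝ) :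
    ‖quadB (Real.cosh ξ) c N b‖ + ‖quadB (-Real.cosh ξ) c N b‖ ≤ 2 * (3 * (c.divisors.card : ℝ) ^ 2 * Real.sqrt c * N * l2 N b) := by
  have h1 := norm_quadB_le_weil (Real.cosh ξ) hc hN b
  have h2 := norm_quadB_le_weil (-Real.cosh ξ) hc hN b
  linarith

/-- (1.26') at `±ch ξ`: `≤ 2Q(c + N) ‖b‖² (1 + ch ξ)`. [cite: DeshouillersIwaniec1982, Proposition 3 (1.26)] -/
theorem pair_le_largeSieve {c : ℕ} (hc : 1 ≤ c) {N : ℝ} (hN : 1 / 2 ≤ N) (b : ℕ → ℂ) (ξ : ℝ) :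
    ‖quadB (Real.cosh ξ) c N b‖ + ‖quadB (-Real.cosh ξ) c N b‖ ≤ 2 * (quadBLSConst * (c + N) * l2 N b) * (1 + Real.cosh ξ) := by
  have h1 := norm_quadB_le_largeSieve (Real.cosh ξ) hc hN b
  have h2 := norm_quadB_le_largeSieve (-Real.cosh ξ) hc hN b
  have hQ := quadBLSConst_pos
  have hch := Real.cosh_pos ξ
  rw [abs_neg] at h2
  rw [abs_of_pos hch] at h1 h2
  have hN0 : 0 ≤ N := by linarith
  have hc0 : (0 : ℝ) ≤ c := by positivity
  have hl2 : 0 ≤ l2 N b := by unfold l2; positivity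
  have hkey : quadBLSConst * (c + N + Real.cosh ξ * N) * l2 N b ≤ quadBLSConst * (c + N) * l2 N b * (1 + Real.cosh ξ) := by
    have : (c + N + Real.cosh ξ * N) ≤ (c + N) * (1 + Real.cosh ξ) := by nlinarith
    calc quadBLSConst * (c + N + Real.cosh ξ * N) * l2 N b ≤ quadBLSConst * ((c + N) * (1 + Real.cosh ξ)) * l2 N b := by gcongr
      _ = _ := by ring
  linarith

/-- (1.27) at `±ch ξ`, `0 < ξ ≤ 1`, `c ≤ N`: `≤ 2A√c N^{1/2+ε} ‖b‖²`. [cite: DeshouillersIwaniec1982, Proposition 3 (1.27)] -/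
theorem pair_le_short {ε A : ℝ} (hA0 : 0 ≤ A) (hA : ShortRange ε A) {c : ℕ} (hc : 1 ≤ c) {N : ℝ} (hcN : (c : ℝ) ≤ N)
    (b : ℕ → ℂ) {ξ : ℝ} (hξ0 : 0 < ξ) (hξ1 : ξ ≤ 1) :
    ‖quadB (Real.cosh ξ) c N b‖ + ‖quadB (-Real.cosh ξ) c N b‖ ≤ 2 * (A * Real.sqrt c * N ^ (1 / 2 + ε) * l2 N b) := by
  have hch1 : 1 ≤ Real.cosh ξ := Real.one_le_cosh ξ
  have hch2 : Real.cosh ξ ≤ 2 := cosh_le_two_of_le_one hξ0.le hξ1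
  have hN0 : 0 ≤ N := le_trans (by positivity) hcN
  have hl2 : 0 ≤ l2 N b := by unfold l2; positivity
  have hrp : |Real.cosh ξ| ^ (-(1 / 2 : ℝ)) ≤ 1 := by
    rw [abs_of_pos (Real.cosh_pos ξ)]
    exact Real.rpow_le_one_of_one_le_of_nonpos hch1 (by norm_num)
  have key : ∀ θ : ℝ, |θ| = Real.cosh ξ → ‖quadB θ c N b‖ ≤ A * Real.sqrt c * N ^ (1 / 2 + ε) * l2 N b := by
    intro θ hθ
    have h := hA θ c N b (by rw [hθ]; positivity) (by rw [hθ]; exact hch2) hc hcN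
    rw [hθ, ← abs_of_pos (Real.cosh_pos ξ)] at h
    calc ‖quadB θ c N b‖ ≤ A * |Real.cosh ξ| ^ (-(1 / 2 : ℝ)) * Real.sqrt c * N ^ (1 / 2 + ε) * l2 N b := h
      _ ≤ A * 1 * Real.sqrt c * N ^ (1 / 2 + ε) * l2 N b := by gcongr
      _ = _ := by ring
  have h1 := key (Real.cosh ξ) (abs_of_pos (Real.cosh_pos ξ))
  have h2 := key (-Real.cosh ξ) (by rw [abs_neg, abs_of_pos (Real.cosh_pos ξ)])
  linarith

/-! ### The four ranges of `c` [DeshouillersIwaniec1982, p. 261] -/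

/-- The form-B prefactor with the Gaussian tail absorbed: for `K ≥ 1`, `M ≥ 0`,
`(2√πK³/c²)(2e^{9/4}K⁻³ M₁ + 4e^{9/2}e^{−K²/2} M₂) ≤ (2√π/c²)(2e^{9/4} M₁ + 192 e^{9/2} M₂)`. [folklore] -/
theorem formB_prefactor_le {K : ℝ} (hK : 1 ≤ K) {N : ℝ} (hN : 0 < N) {c : ℕ} (hc : 1 ≤ c) {M₁ M₂ : ℝ} (hM₂ : 0 ≤ M₂) :
    2 * Real.sqrt π * K ^ 3 * N / (c : ℝ) ^ 2 * (2 * Real.exp (9 / 4) / K ^ 3 * M₁ + 4 * Real.exp (9 / 2) * Real.exp (-(K ^ 2 / 2)) * M₂) ≤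
      2 * Real.sqrt π * N / (c : ℝ) ^ 2 * (2 * Real.exp (9 / 4) * M₁ + 192 * Real.exp (9 / 2) * M₂) := by
  have hK0 : 0 < K := by linarith
  have hc0 : (0 : ℝ) < c := by exact_mod_cast hc
  have h3 := pow_mul_exp_neg_le hK (j := 3) (by norm_num)
  have hid : 2 * Real.sqrt π * K ^ 3 * N / (c : ℝ) ^ 2 * (2 * Real.exp (9 / 4) / K ^ 3 * M₁ + 4 * Real.exp (9 / 2) * Real.exp (-(K ^ 2 / 2)) * M₂) =
      2 * Real.sqrt π * N / (c : ℝ) ^ 2 * (2 * Real.exp (9 / 4) * M₁ + 4 * Real.exp (9 / 2) * (K ^ 3 * Real.exp (-(K ^ 2 / 2))) * M₂) := by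
    field_simp
  rw [hid]
  gcongr 2 * Real.sqrt π * N / (c : ℝ) ^ 2 * (2 * Real.exp (9 / 4) * M₁ + ?_)
  calc 4 * Real.exp (9 / 2) * (K ^ 3 * Real.exp (-(K ^ 2 / 2))) * M₂ ≤ 4 * Real.exp (9 / 2) * 48 * M₂ := by gcongr
    _ = 192 * Real.exp (9 / 2) * M₂ := by ring

/-- The form-A prefactor with the Gaussian tail absorbed: for `K ≥ 1`,
`(2π²Nc)⁻¹(3e^{9/4}π√πK² M₁ + 40e²π√πK⁵e^{−K²/2} M₂) ≤ (√π/(2πNc))(3e^{9/4} K² M₁ + 1920 e² M₂)`. [folklore] -/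
theorem formA_prefactor_le {K : ℝ} (hK : 1 ≤ K) {c : ℕ} (hc : 1 ≤ c) {M₁ M₂ : ℝ} (hM₂ : 0 ≤ M₂) :
    (2 * π ^ 2 * c)⁻¹ * (3 * Real.exp (9 / 4) * (π * Real.sqrt π) * K ^ 2 * M₁ +
      40 * Real.exp 2 * (π * Real.sqrt π) * K ^ 5 * Real.exp (-(K ^ 2 / 2)) * M₂) ≤
      Real.sqrt π / (2 * π * c) * (3 * Real.exp (9 / 4) * K ^ 2 * M₁ + 1920 * Real.exp 2 * M₂) := by
  have hc0 : (0 : ℝ) < c := by exact_mod_cast hc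
  have hπ := Real.pi_pos
  have h5 := pow_mul_exp_neg_le hK (j := 5) (by norm_num)
  have hid : (2 * π ^ 2 * c)⁻¹ * (3 * Real.exp (9 / 4) * (π * Real.sqrt π) * K ^ 2 * M₁ +
      40 * Real.exp 2 * (π * Real.sqrt π) * K ^ 5 * Real.exp (-(K ^ 2 / 2)) * M₂) =
      Real.sqrt π / (2 * π * c) * (3 * Real.exp (9 / 4) * K ^ 2 * M₁ + 40 * Real.exp 2 * (K ^ 5 * Real.exp (-(K ^ 2 / 2))) * M₂) := by
    field_simp
  rw [hid]
  gcongr Real.sqrt π / (2 * π * c) * (3 * Real.exp (9 / 4) * K ^ 2 * M₁ + ?_)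
  calc 40 * Real.exp 2 * (K ^ 5 * Real.exp (-(K ^ 2 / 2))) * M₂ ≤ 40 * Real.exp 2 * 48 * M₂ := by gcongr
    _ = 1920 * Real.exp 2 * M₂ := by ring

/-- **Range `c > N²`** (form B + (1.25)): `‖T_c‖ ≤ C₁ Cτ² N^{1+6ε} c^{−(1+ε)} ‖a‖²`.
[cite: DeshouillersIwaniec1982, §5.3 p. 261] -/
theorem norm_Tc_le_range1 {ε : ℝ} (hε : 0 < ε) (hε1 : ε ≤ 1 / 12) {Cτ : ℝ}
    (hCτ : ∀ c : ℕ, (c.divisors.card : ℝ) ≤ Cτ * (c : ℝ) ^ ε) {r : ℕ} {K : ℝ} (hK : 1 ≤ K) {N : ℝ} (hN : 1 / 2 ≤ N)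
    (a : ℕ → ℂ) {c : ℕ} (hc : 1 ≤ c) (hrc : r ∣ c) (hcN : N ^ 2 < c) :
    ‖Tc r K N a c‖ ≤ 24 * Real.sqrt π * (2 * Real.exp (9 / 4) + 192 * Real.exp (9 / 2)) * Cτ ^ 2 *
      N * N ^ (6 * ε) * (c : ℝ) ^ (-(1 + ε)) * l2 N a := by
  have hN0 : 0 < N := by linarith
  have hc0 : (0 : ℝ) < c := by exact_mod_cast hc
  have hl2 : 0 ≤ l2 N a := by unfold l2; positivity
  have hbTh := l2_bTh_le hN0.le a
  set τ : ℝ := (c.divisors.card : ℝ) with hτ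
  set M : ℝ := 2 * (3 * τ ^ 2 * Real.sqrt c * N * (2 * l2 N a)) with hM
  have hM0 : 0 ≤ M := by positivity
  have hpair : ∀ ξ : ℝ, ‖quadB (Real.cosh ξ) c N (bTh N a)‖ + ‖quadB (-Real.cosh ξ) c N (bTh N a)‖ ≤ M := by
    intro ξ
    refine (pair_le_weil hc hN (bTh N a) ξ).trans ?_
    rw [hM]; gcongr
  have hB := norm_Tc_le_formB hK hN0 a hc hrc hM0 hM0 (M₁ := M) (M₂ := M) (fun ξ _ _ => hpair ξ)
    (fun ξ _ => by
      refine (hpair ξ).trans ?_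
      have : M * 1 ≤ M * (1 + Real.cosh ξ) := by gcongr; linarith [Real.cosh_pos ξ]
      linarith)
  refine hB.trans ((formB_prefactor_le hK hN0 hc hM0).trans ?_)
  -- `τ² ≤ Cτ² c^{2ε}` and `√c N c⁻² c^{2ε} ≤ N^{6ε} c^{−(1+ε)}`
  have hτle : τ ^ 2 ≤ Cτ ^ 2 * ((c : ℝ) ^ ε) ^ 2 := by
    rw [← mul_pow]; exact pow_le_pow_left₀ (by positivity) (hCτ c) 2
  have hgeom : Real.sqrt c * N / (c : ℝ) ^ 2 * ((c : ℝ) ^ ε) ^ 2 ≤ N ^ (6 * ε) * (c : ℝ) ^ (-(1 + ε)) := by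
    have h1 : Real.sqrt c * N / (c : ℝ) ^ 2 * ((c : ℝ) ^ ε) ^ 2 = N * (c : ℝ) ^ (-(3 / 2 : ℝ) + 2 * ε) := by
      rw [Real.sqrt_eq_rpow, ← Real.rpow_natCast ((c : ℝ) ^ ε) 2, ← Real.rpow_mul hc0.le, div_eq_mul_inv,
        ← Real.rpow_natCast (c : ℝ) 2, ← Real.rpow_neg hc0.le]
      rw [show N * (c : ℝ) ^ (-(3 / 2 : ℝ) + 2 * ε) = N * ((c : ℝ) ^ (1 / 2 : ℝ) * (c : ℝ) ^ (-((2 : ℕ) : ℝ)) * (c : ℝ) ^ (ε * (2 : ℕ))) by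
        rw [← Real.rpow_add hc0, ← Real.rpow_add hc0]; push_cast; ring_nf]
      ring
    rw [h1, rpow_split hc0 (-(3 / 2 : ℝ) + 2 * ε) ε]
    have h2 : (c : ℝ) ^ (-(3 / 2 : ℝ) + 2 * ε + 1 + ε) ≤ (N ^ 2) ^ (-(3 / 2 : ℝ) + 2 * ε + 1 + ε) :=
      Real.rpow_le_rpow_of_nonpos (by positivity) hcN.le (by linarith)
    have h3 : (N ^ 2) ^ (-(3 / 2 : ℝ) + 2 * ε + 1 + ε) = N ^ (-1 + 6 * ε) := by
      rw [← Real.rpow_natCast N 2, ← Real.rpow_mul hN0.le]; push_cast; ring_nf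
    have h4 : N * N ^ (-1 + 6 * ε) = N ^ (6 * ε) := by
      rw [show N * N ^ (-1 + 6 * ε) = N ^ (1 : ℝ) * N ^ (-1 + 6 * ε) by rw [Real.rpow_one], ← Real.rpow_add hN0]; ring_nf
    calc N * ((c : ℝ) ^ (-(1 + ε)) * (c : ℝ) ^ (-(3 / 2 : ℝ) + 2 * ε + 1 + ε))
        ≤ N * ((c : ℝ) ^ (-(1 + ε)) * (N ^ 2) ^ (-(3 / 2 : ℝ) + 2 * ε + 1 + ε)) := by gcongr
      _ = N ^ (6 * ε) * (c : ℝ) ^ (-(1 + ε)) := by rw [h3, ← h4]; ring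
  set E : ℝ := 2 * Real.exp (9 / 4) + 192 * Real.exp (9 / 2) with hE
  calc 2 * Real.sqrt π * N / (c : ℝ) ^ 2 * (2 * Real.exp (9 / 4) * M + 192 * Real.exp (9 / 2) * M)
      = 24 * Real.sqrt π * E * τ ^ 2 * N * (Real.sqrt c * N / (c : ℝ) ^ 2) * l2 N a := by rw [hM, hE]; field_simp; ring
    _ ≤ 24 * Real.sqrt π * E * (Cτ ^ 2 * ((c : ℝ) ^ ε) ^ 2) * N * (Real.sqrt c * N / (c : ℝ) ^ 2) * l2 N a := by gcongr
    _ = 24 * Real.sqrt π * E * Cτ ^ 2 * N * (Real.sqrt c * N / (c : ℝ) ^ 2 * ((c : ℝ) ^ ε) ^ 2) * l2 N a := by ring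
    _ ≤ 24 * Real.sqrt π * E * Cτ ^ 2 * N * (N ^ (6 * ε) * (c : ℝ) ^ (-(1 + ε))) * l2 N a := by gcongr
    _ = _ := by ring

/-- **Range `N < c ≤ N²`** (form B + (1.26')): `‖T_c‖ ≤ C₂ Q N^{1+6ε} c^{−(1+ε)} ‖a‖²`.
[cite: DeshouillersIwaniec1982, §5.3 p. 261] -/
theorem norm_Tc_le_range2 {ε : ℝ} (hε : 0 < ε) (hε1 : ε ≤ 1 / 12) {r : ℕ} {K : ℝ} (hK : 1 ≤ K) {N : ℝ} (hN : 1 / 2 ≤ N)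
    (a : ℕ → ℂ) {c : ℕ} (hc : 1 ≤ c) (hrc : r ∣ c) (hNc : N < c) (hcN : (c : ℝ) ≤ N ^ 2) :
    ‖Tc r K N a c‖ ≤ 32 * Real.sqrt π * (6 * Real.exp (9 / 4) + 192 * Real.exp (9 / 2)) * quadBLSConst *
      N * N ^ (6 * ε) * (c : ℝ) ^ (-(1 + ε)) * l2 N a := by
  have hN0 : 0 < N := by linarith
  have hc0 : (0 : ℝ) < c := by exact_mod_cast hc
  have hQ := quadBLSConst_pos
  have hl2 : 0 ≤ l2 N a := by unfold l2; positivity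
  have hbTh := l2_bTh_le hN0.le a
  set M : ℝ := 2 * (quadBLSConst * (c + N) * (2 * l2 N a)) with hM
  have hM0 : 0 ≤ M := by positivity
  have hpair : ∀ ξ : ℝ, ‖quadB (Real.cosh ξ) c N (bTh N a)‖ + ‖quadB (-Real.cosh ξ) c N (bTh N a)‖ ≤ M * (1 + Real.cosh ξ) := by
    intro ξ
    refine (pair_le_largeSieve hc hN (bTh N a) ξ).trans ?_
    have := Real.cosh_pos ξ
    rw [hM]; gcongr
  have hB := norm_Tc_le_formB hK hN0 a hc hrc (by positivity : 0 ≤ 3 * M) hM0 (M₁ := 3 * M) (M₂ := M)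
    (fun ξ hξ hξ1 => by
      have hch := cosh_le_two_of_le_one hξ.le hξ1
      calc _ ≤ M * (1 + Real.cosh ξ) := hpair ξ
        _ ≤ M * 3 := by gcongr; linarith
        _ = 3 * M := mul_comm _ _)
    (fun ξ _ => hpair ξ)
  refine hB.trans ((formB_prefactor_le hK hN0 hc hM0).trans ?_)
  -- `(c + N) c⁻² ≤ 2 c⁻¹ ≤ 2 c^{−(1+ε)} N^{2ε} ≤ 4 c^{−(1+ε)} N^{6ε}`
  have hgeom : (c + N) / (c : ℝ) ^ 2 ≤ 4 * (N ^ (6 * ε) * (c : ℝ) ^ (-(1 + ε))) := by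
    have h1 : (c + N) / (c : ℝ) ^ 2 ≤ 2 * (c : ℝ) ^ (-(1 : ℝ)) := by
      rw [Real.rpow_neg hc0.le, Real.rpow_one, div_le_iff₀ (by positivity)]
      rw [show 2 * (c : ℝ)⁻¹ * (c : ℝ) ^ 2 = 2 * c by field_simp]
      linarith
    have h2 : (c : ℝ) ^ (-(1 : ℝ)) = (c : ℝ) ^ (-(1 + ε)) * (c : ℝ) ^ ε := by
      rw [← Real.rpow_add hc0]; ring_nf
    have h3 : (c : ℝ) ^ ε ≤ N ^ (2 * ε) := by
      calc (c : ℝ) ^ ε ≤ (N ^ 2) ^ ε := Real.rpow_le_rpow hc0.le hcN hε.le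
        _ = N ^ (2 * ε) := by rw [← Real.rpow_natCast N 2, ← Real.rpow_mul hN0.le]; push_cast; ring_nf
    have h4 : N ^ (2 * ε) ≤ 2 * N ^ (6 * ε) := rpow_le_two_mul_rpow hN (by linarith) (by linarith) (by linarith)
    calc (c + N) / (c : ℝ) ^ 2 ≤ 2 * ((c : ℝ) ^ (-(1 + ε)) * (c : ℝ) ^ ε) := by rw [← h2]; exact h1
      _ ≤ 2 * ((c : ℝ) ^ (-(1 + ε)) * (2 * N ^ (6 * ε))) := by gcongr; exact h3.trans h4
      _ = _ := by ring
  set E : ℝ := 6 * Real.exp (9 / 4) + 192 * Real.exp (9 / 2) with hE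
  calc 2 * Real.sqrt π * N / (c : ℝ) ^ 2 * (2 * Real.exp (9 / 4) * (3 * M) + 192 * Real.exp (9 / 2) * M)
      = 8 * Real.sqrt π * E * quadBLSConst * N * ((c + N) / (c : ℝ) ^ 2) * l2 N a := by rw [hM, hE]; field_simp; ring
    _ ≤ 8 * Real.sqrt π * E * quadBLSConst * N * (4 * (N ^ (6 * ε) * (c : ℝ) ^ (-(1 + ε)))) * l2 N a := by gcongr
    _ = _ := by ring

/-- `(N/K²)^v = N^v (K²)^{−v}`. [folklore] -/
theorem div_sq_rpow {N K : ℝ} (hN : 0 ≤ N) (hK : 0 < K) (v : ℝ) : (N / K ^ 2) ^ v = N ^ v * (K ^ 2) ^ (-v) := by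
  rw [Real.div_rpow hN (by positivity), Real.rpow_neg (by positivity), div_eq_mul_inv]

/-- **Range `N/K² < c ≤ N`** (form B + (1.27) on `ξ ≤ 1`, (1.26') on `ξ > 1`):
`‖T_c‖ ≤ (C₃ A K + C₃' Q) N^{1+6ε} c^{−(1+ε)} ‖a‖²`. [cite: DeshouillersIwaniec1982, §5.3 p. 261] -/
theorem norm_Tc_le_range3 {ε A : ℝ} (hε : 0 < ε) (hε1 : ε ≤ 1 / 12) (hA0 : 0 ≤ A) (hA : ShortRange ε A) {r : ℕ} {K : ℝ}
    (hK : 1 ≤ K) {N : ℝ} (hN : 1 / 2 ≤ N) (a : ℕ → ℂ) {c : ℕ} (hc : 1 ≤ c) (hrc : r ∣ c) (hKc : N / K ^ 2 < c)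
    (hcN : (c : ℝ) ≤ N) :
    ‖Tc r K N a c‖ ≤ (32 * Real.sqrt π * Real.exp (9 / 4) * A * K + 6144 * Real.sqrt π * Real.exp (9 / 2) * quadBLSConst) *
      N * N ^ (6 * ε) * (c : ℝ) ^ (-(1 + ε)) * l2 N a := by
  have hN0 : 0 < N := by linarith
  have hK0 : 0 < K := by linarith
  have hc0 : (0 : ℝ) < c := by exact_mod_cast hc
  have hX0 : 0 < N / K ^ 2 := by positivity
  have hQ := quadBLSConst_pos
  have hl2 : 0 ≤ l2 N a := by unfold l2; positivity
  have hbTh := l2_bTh_le hN0.le a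
  set M₁ : ℝ := 2 * (A * Real.sqrt c * N ^ (1 / 2 + ε) * (2 * l2 N a)) with hM₁
  set M₂ : ℝ := 2 * (quadBLSConst * (c + N) * (2 * l2 N a)) with hM₂
  have hM₁0 : 0 ≤ M₁ := by positivity
  have hM₂0 : 0 ≤ M₂ := by positivity
  have hB := norm_Tc_le_formB hK hN0 a hc hrc hM₁0 hM₂0 (M₁ := M₁) (M₂ := M₂)
    (fun ξ hξ hξ1 => by
      refine (pair_le_short hA0 hA hc hcN (bTh N a) hξ hξ1).trans ?_
      rw [hM₁]; gcongr)
    (fun ξ _ => by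
      refine (pair_le_largeSieve hc hN (bTh N a) ξ).trans ?_
      have := Real.cosh_pos ξ
      rw [hM₂]; gcongr)
  refine hB.trans ?_
  have h5 := pow_mul_exp_neg_le hK (j := 5) (by norm_num)
  -- geometry of term 1: `√c N^{1/2+ε} c⁻² ≤ 2 K N^{6ε} c^{−(1+ε)}`
  have hg1 : Real.sqrt c * N ^ (1 / 2 + ε) / (c : ℝ) ^ 2 ≤ 2 * K * (N ^ (6 * ε) * (c : ℝ) ^ (-(1 + ε))) := by
    have h1 : Real.sqrt c * N ^ (1 / 2 + ε) / (c : ℝ) ^ 2 = N ^ (1 / 2 + ε) * ((c : ℝ) ^ (-(1 + ε)) * (c : ℝ) ^ (-(3 / 2 : ℝ) + 1 + ε)) := by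
      rw [← rpow_split hc0, Real.sqrt_eq_rpow, div_eq_mul_inv, ← Real.rpow_natCast (c : ℝ) 2, ← Real.rpow_neg hc0.le,
        show N ^ (1 / 2 + ε) * (c : ℝ) ^ (-(3 / 2 : ℝ)) = N ^ (1 / 2 + ε) * ((c : ℝ) ^ (1 / 2 : ℝ) * (c : ℝ) ^ (-((2 : ℕ) : ℝ))) by
          rw [← Real.rpow_add hc0]; push_cast; ring_nf]
      ring
    have h2 : (c : ℝ) ^ (-(3 / 2 : ℝ) + 1 + ε) ≤ (N / K ^ 2) ^ (-(3 / 2 : ℝ) + 1 + ε) :=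
      Real.rpow_le_rpow_of_nonpos hX0 hKc.le (by linarith)
    have h3 : N ^ (1 / 2 + ε) * (N / K ^ 2) ^ (-(3 / 2 : ℝ) + 1 + ε) = N ^ (2 * ε) * (K ^ 2) ^ (1 / 2 - ε) := by
      rw [div_sq_rpow hN0.le hK0, ← mul_assoc, ← Real.rpow_add hN0]; ring_nf
    have h4 : (K ^ 2) ^ (1 / 2 - ε) ≤ K := sq_rpow_le hK (by linarith)
    have h6 : N ^ (2 * ε) ≤ 2 * N ^ (6 * ε) := rpow_le_two_mul_rpow hN (by linarith) (by linarith) (by linarith)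
    rw [h1]
    calc N ^ (1 / 2 + ε) * ((c : ℝ) ^ (-(1 + ε)) * (c : ℝ) ^ (-(3 / 2 : ℝ) + 1 + ε))
        ≤ N ^ (1 / 2 + ε) * ((c : ℝ) ^ (-(1 + ε)) * (N / K ^ 2) ^ (-(3 / 2 : ℝ) + 1 + ε)) := by gcongr
      _ = (c : ℝ) ^ (-(1 + ε)) * (N ^ (1 / 2 + ε) * (N / K ^ 2) ^ (-(3 / 2 : ℝ) + 1 + ε)) := by ring
      _ = (c : ℝ) ^ (-(1 + ε)) * (N ^ (2 * ε) * (K ^ 2) ^ (1 / 2 - ε)) := by rw [h3]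
      _ ≤ (c : ℝ) ^ (-(1 + ε)) * ((2 * N ^ (6 * ε)) * K) := by gcongr
      _ = _ := by ring
  -- geometry of term 2: `(c + N) c⁻² ≤ 2 N c⁻² ≤ 2 K² N^{ε} c^{−(1+ε)} ≤ 4 K² N^{6ε} c^{−(1+ε)}`
  have hg2 : (c + N) / (c : ℝ) ^ 2 ≤ 4 * K ^ 2 * (N ^ (6 * ε) * (c : ℝ) ^ (-(1 + ε))) := by
    have h1 : (c + N) / (c : ℝ) ^ 2 ≤ 2 * N * ((c : ℝ) ^ (-(1 + ε)) * (c : ℝ) ^ (-(2 : ℝ) + 1 + ε)) := by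
      rw [← rpow_split hc0, show (-(2 : ℝ)) = -((2 : ℕ) : ℝ) by push_cast; ring, Real.rpow_neg hc0.le, Real.rpow_natCast,
        div_eq_mul_inv]
      gcongr
      linarith
    have h2 : (c : ℝ) ^ (-(2 : ℝ) + 1 + ε) ≤ (N / K ^ 2) ^ (-(2 : ℝ) + 1 + ε) :=
      Real.rpow_le_rpow_of_nonpos hX0 hKc.le (by linarith)
    have h3 : N * (N / K ^ 2) ^ (-(2 : ℝ) + 1 + ε) = N ^ ε * (K ^ 2) ^ (1 - ε) := by
      rw [div_sq_rpow hN0.le hK0, ← mul_assoc, show N * N ^ (-(2 : ℝ) + 1 + ε) = N ^ (1 : ℝ) * N ^ (-(2 : ℝ) + 1 + ε) by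
        rw [Real.rpow_one], ← Real.rpow_add hN0]; ring_nf
    have h4 : (K ^ 2) ^ (1 - ε) ≤ K ^ 2 := by
      calc (K ^ 2) ^ (1 - ε) ≤ (K ^ 2) ^ (1 : ℝ) := Real.rpow_le_rpow_of_exponent_le (by nlinarith) (by linarith)
        _ = K ^ 2 := Real.rpow_one _
    have h6 : N ^ ε ≤ 2 * N ^ (6 * ε) := rpow_le_two_mul_rpow hN hε.le (by linarith) (by linarith)
    calc (c + N) / (c : ℝ) ^ 2 ≤ 2 * N * ((c : ℝ) ^ (-(1 + ε)) * (c : ℝ) ^ (-(2 : ℝ) + 1 + ε)) := h1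
      _ ≤ 2 * N * ((c : ℝ) ^ (-(1 + ε)) * (N / K ^ 2) ^ (-(2 : ℝ) + 1 + ε)) := by gcongr
      _ = 2 * (c : ℝ) ^ (-(1 + ε)) * (N * (N / K ^ 2) ^ (-(2 : ℝ) + 1 + ε)) := by ring
      _ = 2 * (c : ℝ) ^ (-(1 + ε)) * (N ^ ε * (K ^ 2) ^ (1 - ε)) := by rw [h3]
      _ ≤ 2 * (c : ℝ) ^ (-(1 + ε)) * ((2 * N ^ (6 * ε)) * K ^ 2) := by gcongr
      _ = _ := by ring
  -- assemble
  have hsplit : 2 * Real.sqrt π * K ^ 3 * N / (c : ℝ) ^ 2 * (2 * Real.exp (9 / 4) / K ^ 3 * M₁ + 4 * Real.exp (9 / 2) * Real.exp (-(K ^ 2 / 2)) * M₂) =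
      16 * Real.sqrt π * Real.exp (9 / 4) * A * N * (Real.sqrt c * N ^ (1 / 2 + ε) / (c : ℝ) ^ 2) * l2 N a +
      32 * Real.sqrt π * Real.exp (9 / 2) * quadBLSConst * N * (K ^ 3 * Real.exp (-(K ^ 2 / 2))) * ((c + N) / (c : ℝ) ^ 2) * l2 N a := by
    rw [hM₁, hM₂]; field_simp; ring
  rw [hsplit]
  have hT1 : 16 * Real.sqrt π * Real.exp (9 / 4) * A * N * (Real.sqrt c * N ^ (1 / 2 + ε) / (c : ℝ) ^ 2) * l2 N a ≤
      16 * Real.sqrt π * Real.exp (9 / 4) * A * N * (2 * K * (N ^ (6 * ε) * (c : ℝ) ^ (-(1 + ε)))) * l2 N a := by gcongr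
  have hT2 : 32 * Real.sqrt π * Real.exp (9 / 2) * quadBLSConst * N * (K ^ 3 * Real.exp (-(K ^ 2 / 2))) * ((c + N) / (c : ℝ) ^ 2) * l2 N a ≤
      32 * Real.sqrt π * Real.exp (9 / 2) * quadBLSConst * N * 192 * (N ^ (6 * ε) * (c : ℝ) ^ (-(1 + ε))) * l2 N a := by
    have hcomb : K ^ 3 * Real.exp (-(K ^ 2 / 2)) * ((c + N) / (c : ℝ) ^ 2) ≤ 192 * (N ^ (6 * ε) * (c : ℝ) ^ (-(1 + ε))) := by
      calc K ^ 3 * Real.exp (-(K ^ 2 / 2)) * ((c + N) / (c : ℝ) ^ 2)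
          ≤ K ^ 3 * Real.exp (-(K ^ 2 / 2)) * (4 * K ^ 2 * (N ^ (6 * ε) * (c : ℝ) ^ (-(1 + ε)))) := by gcongr
        _ = 4 * (K ^ 5 * Real.exp (-(K ^ 2 / 2))) * (N ^ (6 * ε) * (c : ℝ) ^ (-(1 + ε))) := by ring
        _ ≤ 4 * 48 * (N ^ (6 * ε) * (c : ℝ) ^ (-(1 + ε))) := by gcongr
        _ = _ := by ring
    calc 32 * Real.sqrt π * Real.exp (9 / 2) * quadBLSConst * N * (K ^ 3 * Real.exp (-(K ^ 2 / 2))) * ((c + N) / (c : ℝ) ^ 2) * l2 N a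
        = 32 * Real.sqrt π * Real.exp (9 / 2) * quadBLSConst * N * (K ^ 3 * Real.exp (-(K ^ 2 / 2)) * ((c + N) / (c : ℝ) ^ 2)) * l2 N a := by ring
      _ ≤ 32 * Real.sqrt π * Real.exp (9 / 2) * quadBLSConst * N * (192 * (N ^ (6 * ε) * (c : ℝ) ^ (-(1 + ε)))) * l2 N a := by gcongr
      _ = _ := by ring
  refine (add_le_add hT1 hT2).trans (le_of_eq ?_)
  ring

/-- **Range `c ≤ N/K²`** (form A + (1.27) on `ξ ≤ 1`, (1.26') on `ξ > 1`):
`‖T_c‖ ≤ (C₄ A K + C₄' Q) N^{1+6ε} c^{−(1+ε)} ‖a‖²`. [cite: DeshouillersIwaniec1982, §5.3 p. 261] -/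
theorem norm_Tc_le_range4 {ε A : ℝ} (hε : 0 < ε) (hε1 : ε ≤ 1 / 12) (hA0 : 0 ≤ A) (hA : ShortRange ε A) {r : ℕ} {K : ℝ}
    (hK : 1 ≤ K) {N : ℝ} (hN : 1 / 2 ≤ N) (a : ℕ → ℂ) {c : ℕ} (hc : 1 ≤ c) (hrc : r ∣ c) (hcK : (c : ℝ) ≤ N / K ^ 2) :
    ‖Tc r K N a c‖ ≤ (6 * Real.exp (9 / 4) * Real.sqrt π / π * A * K + 7680 * Real.exp 2 * Real.sqrt π / π * quadBLSConst) *
      N * N ^ (6 * ε) * (c : ℝ) ^ (-(1 + ε)) * l2 N a := by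
  have hN0 : 0 < N := by linarith
  have hK0 : 0 < K := by linarith
  have hc0 : (0 : ℝ) < c := by exact_mod_cast hc
  have hπ := Real.pi_pos
  have hQ := quadBLSConst_pos
  have hl2 : 0 ≤ l2 N a := by unfold l2; positivity
  have hcN : (c : ℝ) ≤ N := by
    refine hcK.trans (div_le_self hN0.le ?_)
    nlinarith
  set M₁ : ℝ := 2 * (A * Real.sqrt c * N ^ (1 / 2 + ε) * l2 N a) with hM₁
  set M₂ : ℝ := 2 * (quadBLSConst * (c + N) * l2 N a) with hM₂
  have hM₁0 : 0 ≤ M₁ := by positivity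
  have hM₂0 : 0 ≤ M₂ := by positivity
  have hAf := norm_Tc_le_formA hK N a hc hrc hM₁0 hM₂0 (M₁ := M₁) (M₂ := M₂)
    (fun ξ hξ hξ1 => by
      have h := pair_le_short hA0 hA hc hcN (fun n => conj (a n)) hξ hξ1; rwa [l2_conj, ← hM₁] at h)
    (fun ξ _ => by have h := pair_le_largeSieve hc hN (fun n => conj (a n)) ξ; rwa [l2_conj, ← hM₂] at h)
  refine hAf.trans ((formA_prefactor_le hK hc hM₂0).trans ?_)
  -- geometry of term 1: `K² √c N^{1/2+ε} / (N c) ≤ 2 K N^{6ε} c^{−(1+ε)}`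
  have hg1 : K ^ 2 * (Real.sqrt c * N ^ (1 / 2 + ε)) / (N * c) ≤ 2 * K * (N ^ (6 * ε) * (c : ℝ) ^ (-(1 + ε))) := by
    have h1 : K ^ 2 * (Real.sqrt c * N ^ (1 / 2 + ε)) / (N * c) =
        K ^ 2 * N ^ (-(1 / 2 : ℝ) + ε) * ((c : ℝ) ^ (-(1 + ε)) * (c : ℝ) ^ (-(1 / 2 : ℝ) + 1 + ε)) := by
      rw [← rpow_split hc0, Real.sqrt_eq_rpow]
      rw [show N ^ (-(1 / 2 : ℝ) + ε) = N ^ (1 / 2 + ε) * N ^ (-(1 : ℝ)) by rw [← Real.rpow_add hN0]; ring_nf,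
        show (c : ℝ) ^ (-(1 / 2 : ℝ)) = (c : ℝ) ^ (1 / 2 : ℝ) * (c : ℝ) ^ (-(1 : ℝ)) by rw [← Real.rpow_add hc0]; ring_nf,
        Real.rpow_neg hN0.le, Real.rpow_neg hc0.le, Real.rpow_one, Real.rpow_one]
      field_simp
    have h2 : (c : ℝ) ^ (-(1 / 2 : ℝ) + 1 + ε) ≤ (N / K ^ 2) ^ (-(1 / 2 : ℝ) + 1 + ε) :=
      Real.rpow_le_rpow hc0.le hcK (by linarith)
    have h3 : K ^ 2 * N ^ (-(1 / 2 : ℝ) + ε) * (N / K ^ 2) ^ (-(1 / 2 : ℝ) + 1 + ε) = N ^ (2 * ε) * (K ^ 2) ^ (1 / 2 - ε) := by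
      rw [div_sq_rpow hN0.le hK0, show K ^ 2 * N ^ (-(1 / 2 : ℝ) + ε) * (N ^ (-(1 / 2 : ℝ) + 1 + ε) * (K ^ 2) ^ (-(-(1 / 2 : ℝ) + 1 + ε))) =
        (N ^ (-(1 / 2 : ℝ) + ε) * N ^ (-(1 / 2 : ℝ) + 1 + ε)) * ((K ^ 2) ^ (1 : ℝ) * (K ^ 2) ^ (-(-(1 / 2 : ℝ) + 1 + ε))) by
          rw [Real.rpow_one]; ring,
        ← Real.rpow_add hN0, ← Real.rpow_add (by positivity)]
      ring_nf
    have h4 : (K ^ 2) ^ (1 / 2 - ε) ≤ K := sq_rpow_le hK (by linarith)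
    have h6 : N ^ (2 * ε) ≤ 2 * N ^ (6 * ε) := rpow_le_two_mul_rpow hN (by linarith) (by linarith) (by linarith)
    rw [h1]
    calc K ^ 2 * N ^ (-(1 / 2 : ℝ) + ε) * ((c : ℝ) ^ (-(1 + ε)) * (c : ℝ) ^ (-(1 / 2 : ℝ) + 1 + ε))
        ≤ K ^ 2 * N ^ (-(1 / 2 : ℝ) + ε) * ((c : ℝ) ^ (-(1 + ε)) * (N / K ^ 2) ^ (-(1 / 2 : ℝ) + 1 + ε)) := by gcongr
      _ = (c : ℝ) ^ (-(1 + ε)) * (K ^ 2 * N ^ (-(1 / 2 : ℝ) + ε) * (N / K ^ 2) ^ (-(1 / 2 : ℝ) + 1 + ε)) := by ring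
      _ = (c : ℝ) ^ (-(1 + ε)) * (N ^ (2 * ε) * (K ^ 2) ^ (1 / 2 - ε)) := by rw [h3]
      _ ≤ (c : ℝ) ^ (-(1 + ε)) * ((2 * N ^ (6 * ε)) * K) := by gcongr
      _ = _ := by ring
  -- geometry of term 2: `(c + N)/(N c) ≤ 2/c ≤ 2 N^{ε} c^{−(1+ε)} ≤ 4 N^{6ε} c^{−(1+ε)}`
  have hg2 : (c + N) / (N * c) ≤ 4 * (N ^ (6 * ε) * (c : ℝ) ^ (-(1 + ε))) := by
    have h1 : (c + N) / (N * c) ≤ 2 * ((c : ℝ) ^ (-(1 + ε)) * (c : ℝ) ^ (-(1 : ℝ) + 1 + ε)) := by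
      rw [← rpow_split hc0, Real.rpow_neg hc0.le, Real.rpow_one, div_le_iff₀ (by positivity)]
      rw [show 2 * (c : ℝ)⁻¹ * (N * c) = 2 * N by field_simp]
      linarith
    have h2 : (c : ℝ) ^ (-(1 : ℝ) + 1 + ε) ≤ N ^ (-(1 : ℝ) + 1 + ε) := Real.rpow_le_rpow hc0.le hcN (by linarith)
    have h3 : N ^ (-(1 : ℝ) + 1 + ε) = N ^ ε := by ring_nf
    have h6 : N ^ ε ≤ 2 * N ^ (6 * ε) := rpow_le_two_mul_rpow hN hε.le (by linarith) (by linarith)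
    calc (c + N) / (N * c) ≤ 2 * ((c : ℝ) ^ (-(1 + ε)) * (c : ℝ) ^ (-(1 : ℝ) + 1 + ε)) := h1
      _ ≤ 2 * ((c : ℝ) ^ (-(1 + ε)) * N ^ (-(1 : ℝ) + 1 + ε)) := by gcongr
      _ ≤ 2 * ((c : ℝ) ^ (-(1 + ε)) * (2 * N ^ (6 * ε))) := by rw [h3]; gcongr
      _ = _ := by ring
  have hsplit : Real.sqrt π / (2 * π * c) * (3 * Real.exp (9 / 4) * K ^ 2 * M₁ + 1920 * Real.exp 2 * M₂) =
      3 * Real.exp (9 / 4) * Real.sqrt π / π * A * N * (K ^ 2 * (Real.sqrt c * N ^ (1 / 2 + ε)) / (N * c)) * l2 N a +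
      1920 * Real.exp 2 * Real.sqrt π / π * quadBLSConst * N * ((c + N) / (N * c)) * l2 N a := by
    rw [hM₁, hM₂]; field_simp
  rw [hsplit]
  have hT1 : 3 * Real.exp (9 / 4) * Real.sqrt π / π * A * N * (K ^ 2 * (Real.sqrt c * N ^ (1 / 2 + ε)) / (N * c)) * l2 N a ≤
      3 * Real.exp (9 / 4) * Real.sqrt π / π * A * N * (2 * K * (N ^ (6 * ε) * (c : ℝ) ^ (-(1 + ε)))) * l2 N a := by gcongr
  have hT2 : 1920 * Real.exp 2 * Real.sqrt π / π * quadBLSConst * N * ((c + N) / (N * c)) * l2 N a ≤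
      1920 * Real.exp 2 * Real.sqrt π / π * quadBLSConst * N * (4 * (N ^ (6 * ε) * (c : ℝ) ^ (-(1 + ε)))) * l2 N a := by gcongr
  refine (add_le_add hT1 hT2).trans (le_of_eq ?_)
  ring

/-- `T_c = 0` unless `1 ≤ c` and `r ∣ c`. [folklore] -/
theorem Tc_eq_zero_of_not {r : ℕ} (K N : ℝ) (a : ℕ → ℂ) {c : ℕ} (h : ¬(1 ≤ c ∧ r ∣ c)) : Tc r K N a c = 0 := by
  unfold Tc kuzTerm
  simp [if_neg h]

/-- **The uniform bound per modulus** [DeshouillersIwaniec1982, §5.3 p. 261, the four ranges combined]: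
`‖T_c‖ ≤ C K N^{1+6ε} c^{−(1+ε)} ‖a‖²` for all `c ≥ 1` with `r ∣ c` (and `T_c = 0` otherwise).
[cite: DeshouillersIwaniec1982, §5.3 p. 261] -/
theorem norm_Tc_le {ε A : ℝ} (hε : 0 < ε) (hε1 : ε ≤ 1 / 12) (hA0 : 0 ≤ A) (hA : ShortRange ε A) :
    ∃ C : ℝ, 0 ≤ C ∧ ∀ (r : ℕ) (K N : ℝ) (a : ℕ → ℂ) (c : ℕ), 1 ≤ K → 1 / 2 ≤ N →
      ‖Tc r K N a c‖ ≤ C * K * (N * N ^ (6 * ε)) * (if 1 ≤ c ∧ r ∣ c then (c : ℝ) ^ (-(1 + ε)) else 0) * l2 N a := by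
  obtain ⟨Cτ, hC1, hCτ⟩ := exists_card_divisors_le_mul_rpow' hε
  have hQ := quadBLSConst_pos
  set C₁ : ℝ := 24 * Real.sqrt π * (2 * Real.exp (9 / 4) + 192 * Real.exp (9 / 2)) * Cτ ^ 2 with hC₁
  set C₂ : ℝ := 32 * Real.sqrt π * (6 * Real.exp (9 / 4) + 192 * Real.exp (9 / 2)) * quadBLSConst with hC₂
  set C₃ : ℝ := 32 * Real.sqrt π * Real.exp (9 / 4) * A + 6144 * Real.sqrt π * Real.exp (9 / 2) * quadBLSConst with hC₃
  set C₄ : ℝ := 6 * Real.exp (9 / 4) * Real.sqrt π / π * A + 7680 * Real.exp 2 * Real.sqrt π / π * quadBLSConst with hC₄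
  have hC₁0 : 0 ≤ C₁ := by positivity
  have hC₂0 : 0 ≤ C₂ := by positivity
  have hC₃0 : 0 ≤ C₃ := by positivity
  have hC₄0 : 0 ≤ C₄ := by positivity
  refine ⟨C₁ + C₂ + C₃ + C₄, by positivity, fun r K N a c hK hN => ?_⟩
  have hl2 : 0 ≤ l2 N a := by unfold l2; positivity
  have hK0 : 0 < K := by linarith
  have hN0 : 0 < N := by linarith
  by_cases hcr : 1 ≤ c ∧ r ∣ c
  swap
  · rw [Tc_eq_zero_of_not K N a hcr, norm_zero, if_neg hcr]; simp
  rw [if_pos hcr]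
  obtain ⟨hc, hrc⟩ := hcr
  have hc0 : (0 : ℝ) < c := by exact_mod_cast hc
  set U : ℝ := N * N ^ (6 * ε) * (c : ℝ) ^ (-(1 + ε)) * l2 N a with hU
  have hU0 : 0 ≤ U := by positivity
  -- each range gives `≤ Cᵢ K U`
  have hgoal : ∀ Ci : ℝ, 0 ≤ Ci → Ci ≤ C₁ + C₂ + C₃ + C₄ → ‖Tc r K N a c‖ ≤ Ci * K * U →
      ‖Tc r K N a c‖ ≤ (C₁ + C₂ + C₃ + C₄) * K * (N * N ^ (6 * ε)) * (c : ℝ) ^ (-(1 + ε)) * l2 N a := by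
    intro Ci hCi hle h
    calc ‖Tc r K N a c‖ ≤ Ci * K * U := h
      _ ≤ (C₁ + C₂ + C₃ + C₄) * K * U := by gcongr
      _ = _ := by rw [hU]; ring
  rcases lt_or_ge (N ^ 2) (c : ℝ) with h1 | h1
  · -- range 1
    refine hgoal C₁ hC₁0 (by linarith) ?_
    have h := norm_Tc_le_range1 hε hε1 hCτ hK hN a hc hrc h1
    calc ‖Tc r K N a c‖ ≤ C₁ * N * N ^ (6 * ε) * (c : ℝ) ^ (-(1 + ε)) * l2 N a := h
      _ = C₁ * 1 * U := by rw [hU]; ring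
      _ ≤ C₁ * K * U := by gcongr
  rcases lt_or_ge N (c : ℝ) with h2 | h2
  · -- range 2
    refine hgoal C₂ hC₂0 (by linarith) ?_
    have h := norm_Tc_le_range2 hε hε1 hK hN a hc hrc h2 h1
    calc ‖Tc r K N a c‖ ≤ C₂ * N * N ^ (6 * ε) * (c : ℝ) ^ (-(1 + ε)) * l2 N a := h
      _ = C₂ * 1 * U := by rw [hU]; ring
      _ ≤ C₂ * K * U := by gcongr
  rcases lt_or_ge (N / K ^ 2) (c : ℝ) with h3 | h3
  · -- range 3
    refine hgoal C₃ hC₃0 (by linarith) ?_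
    have h := norm_Tc_le_range3 hε hε1 hA0 hA hK hN a hc hrc h3 h2
    have hx : 6144 * Real.sqrt π * Real.exp (9 / 2) * quadBLSConst ≤ 6144 * Real.sqrt π * Real.exp (9 / 2) * quadBLSConst * K :=
      le_mul_of_one_le_right (by positivity) hK
    calc ‖Tc r K N a c‖ ≤ (32 * Real.sqrt π * Real.exp (9 / 4) * A * K + 6144 * Real.sqrt π * Real.exp (9 / 2) * quadBLSConst) *
          N * N ^ (6 * ε) * (c : ℝ) ^ (-(1 + ε)) * l2 N a := h
      _ = (32 * Real.sqrt π * Real.exp (9 / 4) * A * K + 6144 * Real.sqrt π * Real.exp (9 / 2) * quadBLSConst) * U := by rw [hU]; ring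
      _ ≤ (32 * Real.sqrt π * Real.exp (9 / 4) * A * K + 6144 * Real.sqrt π * Real.exp (9 / 2) * quadBLSConst * K) * U :=
          mul_le_mul_of_nonneg_right (by linarith) hU0
      _ = C₃ * K * U := by rw [hC₃]; ring
  · -- range 4
    refine hgoal C₄ hC₄0 (by linarith) ?_
    have h := norm_Tc_le_range4 hε hε1 hA0 hA hK hN a hc hrc h3
    have hx : 7680 * Real.exp 2 * Real.sqrt π / π * quadBLSConst ≤ 7680 * Real.exp 2 * Real.sqrt π / π * quadBLSConst * K :=
      le_mul_of_one_le_right (by positivity) hK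
    calc ‖Tc r K N a c‖ ≤ (6 * Real.exp (9 / 4) * Real.sqrt π / π * A * K + 7680 * Real.exp 2 * Real.sqrt π / π * quadBLSConst) *
          N * N ^ (6 * ε) * (c : ℝ) ^ (-(1 + ε)) * l2 N a := h
      _ = (6 * Real.exp (9 / 4) * Real.sqrt π / π * A * K + 7680 * Real.exp 2 * Real.sqrt π / π * quadBLSConst) * U := by rw [hU]; ring
      _ ≤ (6 * Real.exp (9 / 4) * Real.sqrt π / π * A * K + 7680 * Real.exp 2 * Real.sqrt π / π * quadBLSConst * K) * U :=
          mul_le_mul_of_nonneg_right (by linarith) hU0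
      _ = C₄ * K * U := by rw [hC₄]; ring

/-- **The Kloosterman side of Kuznetsov's formula for `h = h_K`, paired with `ā_m a_n` and summed over
the moduli `c ≡ 0 (mod r)`** [DeshouillersIwaniec1982, §5.3 p. 261: `Σ_c c⁻¹|Φ(c,K,N)| ≪ μKN^{1+ε}(…)`],
in the normalisation of [Iwaniec2002, (9.12)] divided by `4π`:
`Σ_c ‖T_c‖ ≤ C K N^{1+6ε} r⁻¹ ‖a‖²` for `K ≥ 1`, `r ≥ 1`, `N ≥ 1/2`.
[cite: DeshouillersIwaniec1982, §5.3 p. 261] -/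
theorem kloostermanSide_le {ε A : ℝ} (hε : 0 < ε) (hε1 : ε ≤ 1 / 12) (hA0 : 0 ≤ A) (hA : ShortRange ε A) :
    ∃ C : ℝ, 0 ≤ C ∧ ∀ (r : ℕ) (K N : ℝ) (a : ℕ → ℂ), 1 ≤ r → 1 ≤ K → 1 / 2 ≤ N →
      Summable (fun c => ‖Tc r K N a c‖) ∧ ∑' c, ‖Tc r K N a c‖ ≤ C * K * N ^ (1 + 6 * ε) / r * l2 N a := by
  obtain ⟨C, hC0, hC⟩ := norm_Tc_le hε hε1 hA0 hA
  set ζ : ℝ := ∑' j : ℕ, (j : ℝ) ^ (-(1 + ε)) with hζ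
  have hζ0 : 0 ≤ ζ := tsum_nonneg fun j => by positivity
  refine ⟨C * ζ, by positivity, fun r K N a hr hK hN => ?_⟩
  obtain ⟨hsum, hle⟩ := tsum_level_le hε hr
  have hl2 : 0 ≤ l2 N a := by unfold l2; positivity
  have hK0 : 0 < K := by linarith
  have hN0 : 0 < N := by linarith
  have hr0 : (0 : ℝ) < r := by exact_mod_cast hr
  have hNN : N * N ^ (6 * ε) = N ^ (1 + 6 * ε) := by
    rw [Real.rpow_add hN0, Real.rpow_one]
  set B : ℝ := C * K * (N * N ^ (6 * ε)) * l2 N a with hB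
  have hB0 : 0 ≤ B := by positivity
  have hpt : ∀ c, ‖Tc r K N a c‖ ≤ B * (if 1 ≤ c ∧ r ∣ c then (c : ℝ) ^ (-(1 + ε)) else 0) := by
    intro c
    calc ‖Tc r K N a c‖ ≤ C * K * (N * N ^ (6 * ε)) * (if 1 ≤ c ∧ r ∣ c then (c : ℝ) ^ (-(1 + ε)) else 0) * l2 N a :=
          hC r K N a c hK hN
      _ = _ := by rw [hB]; ring
  have hs : Summable fun c => ‖Tc r K N a c‖ := Summable.of_nonneg_of_le (fun c => norm_nonneg _) hpt (hsum.mul_left B)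
  refine ⟨hs, ?_⟩
  calc ∑' c, ‖Tc r K N a c‖ ≤ ∑' c, B * (if 1 ≤ c ∧ r ∣ c then (c : ℝ) ^ (-(1 + ε)) else 0) :=
        Summable.tsum_le_tsum hpt hs (hsum.mul_left B)
    _ = B * ∑' c, (if 1 ≤ c ∧ r ∣ c then (c : ℝ) ^ (-(1 + ε)) else 0) := tsum_mul_left
    _ ≤ B * ((r : ℝ)⁻¹ * ζ) := by gcongr
    _ = C * ζ * K * N ^ (1 + 6 * ε) / r * l2 N a := by rw [hB, hNN]; field_simp

end Forms

end DeshouillersIwaniec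

end Literature.NumberTheory.Sieve
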